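import Literature.Analysis.FluidPDE.TaoAveragedRotationDisintegration
import Literature.Analysis.FluidPDE.TaoAveragedFibreIdentity

import Mathlib.Analysis.Calculus.BumpFunction.InnerProduct
import Mathlib.Analysis.Distribution.SchwartzSpace.Fourier
import HarnessLib

/-!
# Tao 2016, §3.6–§3.9: the data of the joint-weight rotation average (quaternion coordinates)

T. Tao, *Finite time blowup for an averaged three-dimensional Navier–Stokes equation*,
J. Amer. Math. Soc. **29** (2016), 601–674 = arXiv:1402.0290v3, §3.6–§3.9 pp. 18–20.  This file
constructs the data `(d, μ₀, E, F)` witnessing the named fact `rotationAverage_jointWeight`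
(`TaoAveragedRotationAveraging.lean`) and proves their structural properties; the identity itself
(`rotationAverage_jointWeight_holds`) is not yet in the tree and is to be proved in a sequel from
these data, `TaoAveragedRotationDisintegration.lean` and `TaoAveragedTorusAveraging.lean`.

* **Parameter space.** `d = 4`: `V = (Fin 4 → ℝ³) ≅ Q = ℍ × ℍ × ℍ` through the linear
  isomorphism `quatTripleEquiv` (a `4 × 3` real array read column-wise as three quaternions); the
  three rotations are `E j ω = ρ(qⱼ)` (`qrot`, `slotQ`: slot `1 ↦ b`, `2 ↦ c`, `3 ↦ a` for
  `q = (a, (b, c))`), a measurable `SO(3)`-valued family (`isRotationFamily_jointE`); the measure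
  is Lebesgue measure on `Q` with the radial density `∏ⱼ g₀(|qⱼ|)` transported to `V`
  (`jointMeasure`, finite).  This replaces Tao's `U ⊂ SO(3)³` with Haar measure (§3.6).
* **The joint weight** `F(ω, ξ₁, ξ₂) = Fflat(q, p)` (`jointF`), Tao's `F̃'`: a product of real
  cut-offs — `qCut` (`|qⱼ|` in a shell), `pRad` (the magnitudes `|ξⱼ|` within `O(ε₀³)` of
  `|ξⱼ⁰|`, times the Jacobian factor `|ξ₁||ξ₂||ξ₃|`), `pFrame` (the direction of `ξ₃` and the unit
  normal of the triangle within `ε₀³` of those of (3.7) — this is Tao's restriction (3.14) to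
  rotations almost fixing `ξⱼ⁰`, made `T³`-invariant), `zCut` (the un-rotated frequencies
  `ζⱼ = ρ(q̄ⱼ)ξⱼ` in `B(ξⱼ⁰, 2ε₀³)`), the normalising constant of the disintegration
  (`rotDensityConst`) — times the *synthesis sum*
  `Ssum = Σ_σ λ_σ(ξ)⁻¹ ∏ⱼ W^{σⱼ}ⱼ(ξ) · cⱼ`, `cⱼ = (ρ(qⱼ) ⊗ 1) P_{ζⱼ} \overline{ψ̂ⱼ(ζⱼ)}`
  (§3.8–3.9 through `TaoAveragedFibreIdentity.lean`).
* Proved here: `isRotationFamily_jointE`; finiteness of the measure and the integration formula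
  (`isFiniteMeasure_jointMeasure`, `integral_jointMeasure`); the equivariance lemmas under the
  angle actions (`cdot_frameW_rotMat_rodRotEquiv`, `rotMat_qrot_quatExp`, …); the **localisation
  lemma** `near_xi0_of_cutoffs` (on the support of the cut-offs the closed triangle `ξ` is within
  `100 ε₀³` of (3.7)); hence Tao's weight `φ η ≡ 1` there (`singleScaleWeight_eq_one_of_cutoffs`,
  cf. (3.14)); positivity and finiteness of the disintegration constant
  (`rotDensityConstE_pos_lt_top`, `rotDensityConst_pos`); smoothness (`contDiff_Fflat`,
  `contDiff_jointF`, for `200 ε₀³ < δ` with `δ` the non-degeneracy radius `ndDelta` of (3.24)) and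
  compact support (`hasCompactSupport_Fflat`, `hasCompactSupport_jointF`).

## References

* T. Tao, J. Amer. Math. Soc. 29 (2016), 601–674, arXiv:1402.0290v3, §3.6 (3.14)–(3.16) p. 18,
  §3.7–3.9 pp. 19–20. Key `Tao2016AveragedNS`.
-/

noncomputable section

open Real MeasureTheory Quaternion Set FourierTransform
open scoped RealInnerProductSpace Quaternion ENNReal ComplexConjugate SchwartzMap

namespace Literature.Analysis.FluidPDE.Tao2016

/-- Local notation for physical / frequency space `ℝ³`. -/
local notation "ℝ³" => EuclideanSpace ℝ (Fin 3)
/-- Local notation for the complexified range `ℂ³`. -/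
local notation "ℂ³" => EuclideanSpace ℂ (Fin 3)

open FunctionSpaces.EuclideanSpace (complexify complexify_apply)

attribute [local instance] quatMeasurableSpace quatBorelSpace

/-! ### The parameter space `V = (Fin 4 → ℝ³) ≅ ℍ³` -/

section ParameterSpace

/-- The quaternion read off the `k`-th column of a `4 × 3` array `ω : Fin 4 → ℝ³`. [folklore] -/
def colQuat (ω : Fin 4 → ℝ³) (k : Fin 3) : ℍ := ⟨ω 0 k, ω 1 k, ω 2 k, ω 3 k⟩

/-- The real components of a quaternion as a `Fin 4`-vector. [folklore] -/
def quatCmp (q : ℍ) : Fin 4 → ℝ := ![q.re, q.imI, q.imJ, q.imK]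

/-- **The identification `V = (Fin 4 → ℝ³) ≅ Q = ℍ × ℍ × ℍ`**: the columns `2, 0, 1` of the array
are the quaternions `a, b, c` of the slots `3, 1, 2`. [folklore] -/
def quatTripleEquiv : (Fin 4 → ℝ³) ≃ₗ[ℝ] (ℍ × ℍ × ℍ) where
  toFun ω := (colQuat ω 2, colQuat ω 0, colQuat ω 1)
  invFun q := fun i => !₂[quatCmp q.2.1 i, quatCmp q.2.2 i, quatCmp q.1 i]
  map_add' ω ω' := by
    ext <;> simp [colQuat]
  map_smul' c ω := by
    ext <;> simp [colQuat]
  left_inv ω := by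
    funext i
    ext k
    fin_cases i <;> fin_cases k <;> simp [colQuat, quatCmp]
  right_inv q := by
    ext <;> simp [colQuat, quatCmp]

/-- `quatTripleEquiv` as a continuous linear isomorphism (finite dimensions). [folklore] -/
def quatTripleCLE : (Fin 4 → ℝ³) ≃L[ℝ] (ℍ × ℍ × ℍ) := quatTripleEquiv.toContinuousLinearEquiv

/-- `quatTripleCLE` acts as `quatTripleEquiv`. [folklore] -/
@[simp] theorem quatTripleCLE_apply (ω : Fin 4 → ℝ³) : quatTripleCLE ω = quatTripleEquiv ω := rfl

/-- The quaternion of slot `j` in `q = (a, (b, c))`: slot `1 ↦ b`, `2 ↦ c`, `3 ↦ a` (the gauge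
quaternion `a` acts on the closing frequency `ξ₃ = -ξ₁-ξ₂`, as in `rotFreq`). [folklore] -/
def slotQ (q : ℍ × ℍ × ℍ) (j : Fin 3) : ℍ := ![q.2.1, q.2.2, q.1] j

/-- `slotQ q 0 = b`. [folklore] -/
@[simp] theorem slotQ_zero (q : ℍ × ℍ × ℍ) : slotQ q 0 = q.2.1 := rfl
/-- `slotQ q 1 = c`. [folklore] -/
@[simp] theorem slotQ_one (q : ℍ × ℍ × ℍ) : slotQ q 1 = q.2.2 := rfl
/-- `slotQ q 2 = a`. [folklore] -/
@[simp] theorem slotQ_two (q : ℍ × ℍ × ℍ) : slotQ q 2 = q.1 := rfl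

/-- The three frequencies `(ξ₁, ξ₂, ξ₃ = -ξ₁-ξ₂)` of a pair. [cite: Tao2016AveragedNS, §3.5 p. 17] -/
def freq3 (p : ℝ³ × ℝ³) : Fin 3 → ℝ³ := ![p.1, p.2, -p.1 - p.2]

/-- `freq3 p 0 = ξ₁`. [folklore] -/
@[simp] theorem freq3_zero (p : ℝ³ × ℝ³) : freq3 p 0 = p.1 := rfl
/-- `freq3 p 1 = ξ₂`. [folklore] -/
@[simp] theorem freq3_one (p : ℝ³ × ℝ³) : freq3 p 1 = p.2 := rfl
/-- `freq3 p 2 = ξ₃ = -ξ₁ - ξ₂`. [folklore] -/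
@[simp] theorem freq3_two (p : ℝ³ × ℝ³) : freq3 p 2 = -p.1 - p.2 := rfl

/-- The frequencies close up: `ξ₁ + ξ₂ + ξ₃ = 0`. [cite: Tao2016AveragedNS, §3.7 (3.18) p. 19] -/
theorem freq3_sum (p : ℝ³ × ℝ³) : freq3 p 0 + freq3 p 1 + freq3 p 2 = 0 := by
  simp only [freq3_zero, freq3_one, freq3_two]; abel

/-- **The rotation family `E j ω = ρ(qⱼ)`** on `V`. [cite: Tao2016AveragedNS, Def. 3.4 and §3.6 p. 18] -/
def jointE (j : Fin 3) (ω : Fin 4 → ℝ³) : ℝ³ ≃ₗᵢ[ℝ] ℝ³ := qrot (slotQ (quatTripleEquiv ω) j)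

/-- `jointE` is a measurable `SO(3)`-valued family. [cite: Tao2016AveragedNS, Def. 3.4] -/
theorem isRotationFamily_jointE : IsRotationFamily jointE := by
  refine ⟨fun j ω => det_qrot _, fun j x => ?_⟩
  have hc : Continuous fun ω : Fin 4 → ℝ³ => slotQ (quatTripleEquiv ω) j := by
    have h := quatTripleCLE.continuous
    fin_cases j
    · exact (continuous_fst.comp continuous_snd).comp h
    · exact (continuous_snd.comp continuous_snd).comp h
    · exact continuous_fst.comp h
  exact (measurable_qrot_apply x).comp hc.measurable

/-! ### Radial profiles and the measure -/

/-- The radial profile `g₀` of the quaternion density: a smooth bump in `|q|` equal to `1` on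
`[3/4, 5/4]` and supported in `[1/2, 3/2]`. [folklore] -/
def gBump : ContDiffBump (1 : ℝ) := ⟨1 / 4, 1 / 2, by norm_num, by norm_num⟩

/-- The radial cut-off `g₂` inside the weight, as a function of `t = |q|²`: a smooth bump equal to
`1` on `[1/2, 3/2]`, supported in `[1/4, 7/4]` (so vanishing for `|q| < 1/2`). [folklore] -/
def gBump2 : ContDiffBump (1 : ℝ) := ⟨1 / 2, 3 / 4, by norm_num, by norm_num⟩

/-- **The density `∏ⱼ g₀(|qⱼ|)`** of the quaternion measure (the substitute for Haar measure on
`U ⊂ SO(3)³`). [cite: Tao2016AveragedNS, §3.6 p. 18] -/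
def qDensity (q : ℍ × ℍ × ℍ) : ℝ := gBump ‖q.1‖ * gBump ‖q.2.1‖ * gBump ‖q.2.2‖

/-- The density is non-negative. [folklore] -/
theorem qDensity_nonneg (q : ℍ × ℍ × ℍ) : 0 ≤ qDensity q :=
  mul_nonneg (mul_nonneg gBump.nonneg gBump.nonneg) gBump.nonneg

/-- The density is at most `1`. [folklore] -/
theorem qDensity_le_one (q : ℍ × ℍ × ℍ) : qDensity q ≤ 1 :=
  mul_le_one₀ (mul_le_one₀ gBump.le_one gBump.nonneg gBump.le_one) gBump.nonneg gBump.le_one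

/-- The density is continuous. [folklore] -/
theorem continuous_qDensity : Continuous qDensity := by
  unfold qDensity
  exact ((gBump.continuous.comp continuous_fst.norm).mul
    (gBump.continuous.comp (continuous_fst.comp continuous_snd).norm)).mul
    (gBump.continuous.comp (continuous_snd.comp continuous_snd).norm)

/-- The density vanishes unless all `|qⱼ| ≤ 3/2`. [folklore] -/
theorem qDensity_eq_zero {q : ℍ × ℍ × ℍ} (h : (3 / 2 : ℝ) < ‖q.1‖ ∨ (3 / 2 : ℝ) < ‖q.2.1‖ ∨ (3 / 2 : ℝ) < ‖q.2.2‖) :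
    qDensity q = 0 := by
  have key : ∀ t : ℝ, (3 / 2 : ℝ) < t → (gBump : ℝ → ℝ) t = 0 := fun t ht =>
    gBump.zero_of_le_dist (by rw [Real.dist_eq, gBump]; rw [abs_of_pos (by linarith)]; linarith)
  unfold qDensity
  rcases h with h | h | h
  · rw [key _ h]; ring
  · rw [key _ h]; ring
  · rw [key _ h]; ring

/-- The quaternion measure `∏ⱼ g₀(|qⱼ|) dq` on `Q`. [cite: Tao2016AveragedNS, §3.6 p. 18] -/
def qMeasure : Measure (ℍ × ℍ × ℍ) := volume.withDensity fun q => ENNReal.ofReal (qDensity q)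

/-- The quaternion measure is finite (bounded density, bounded support). [folklore] -/
theorem isFiniteMeasure_qMeasure : IsFiniteMeasure qMeasure := by
  refine ⟨?_⟩
  rw [qMeasure, withDensity_apply _ MeasurableSet.univ, Measure.restrict_univ]
  set K : Set (ℍ × ℍ × ℍ) := Metric.closedBall 0 2 ×ˢ (Metric.closedBall 0 2 ×ˢ Metric.closedBall 0 2) with hK
  have hKc : IsCompact K := (isCompact_closedBall 0 2).prod ((isCompact_closedBall 0 2).prod (isCompact_closedBall 0 2))
  have hzero : ∀ q, q ∉ K → ENNReal.ofReal (qDensity q) = 0 := by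
    intro q hq
    rw [qDensity_eq_zero, ENNReal.ofReal_zero]
    simp only [hK, mem_prod, Metric.mem_closedBall, dist_zero_right, not_and_or, not_le] at hq
    rcases hq with h | h | h
    · exact Or.inl (by linarith)
    · exact Or.inr (Or.inl (by linarith))
    · exact Or.inr (Or.inr (by linarith))
  have hle : (fun q => ENNReal.ofReal (qDensity q)) ≤ K.indicator (fun _ => (1 : ℝ≥0∞)) := by
    intro q
    show ENNReal.ofReal (qDensity q) ≤ _
    by_cases hq : q ∈ K
    · rw [indicator_of_mem hq]; exact ENNReal.ofReal_le_one.mpr (qDensity_le_one q)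
    · rw [hzero q hq]; exact zero_le
  calc ∫⁻ q, ENNReal.ofReal (qDensity q) ≤ ∫⁻ q, K.indicator (fun _ => (1 : ℝ≥0∞)) q := lintegral_mono hle
    _ = volume K := by rw [lintegral_indicator hKc.measurableSet, setLIntegral_const, one_mul]
    _ < ⊤ := hKc.measure_lt_top

/-- **The measure `μ₀` on `V`**: the quaternion measure transported along `quatTripleEquiv`. [cite: Tao2016AveragedNS, §3.6 p. 18] -/
def jointMeasure : Measure (Fin 4 → ℝ³) :=
  Measure.map quatTripleCLE.symm.toHomeomorph.toMeasurableEquiv qMeasure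

/-- `μ₀` is finite. [folklore] -/
theorem isFiniteMeasure_jointMeasure : IsFiniteMeasure jointMeasure := by
  haveI := isFiniteMeasure_qMeasure
  unfold jointMeasure
  infer_instance

/-- Integration against `μ₀` is integration against the quaternion density on `Q`. [folklore] -/
theorem integral_jointMeasure {E : Type*} [NormedAddCommGroup E] [NormedSpace ℝ E] (f : (Fin 4 → ℝ³) → E) :
    ∫ ω, f ω ∂jointMeasure = ∫ q, qDensity q • f (quatTripleCLE.symm q) := by
  rw [jointMeasure, integral_map_equiv]
  simp only [Homeomorph.toMeasurableEquiv_coe, ContinuousLinearEquiv.coe_toHomeomorph]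
  rw [qMeasure, integral_withDensity_eq_integral_toReal_smul₀ (by
    exact (ENNReal.measurable_ofReal.comp continuous_qDensity.measurable).aemeasurable)
    (Filter.Eventually.of_forall fun _ => ENNReal.ofReal_lt_top)]
  refine integral_congr_ae (Filter.Eventually.of_forall fun q => ?_)
  simp only [ENNReal.toReal_ofReal (qDensity_nonneg q)]

end ParameterSpace
/-! ### The cut-offs and the synthesis sum: the joint weight `F̃'` -/

section Weight

variable (ε₀ : ℝ) (ψ : Fin 3 → 𝓢(ℝ³, ℂ³))

/-- A smooth bump of inner radius `r` and outer radius `2r` around `c` (requires `r > 0`). [folklore] -/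
def bump2 {X : Type*} [NormedAddCommGroup X] [NormedSpace ℝ X] (c : X) {r : ℝ} (hr : 0 < r) : ContDiffBump c :=
  ⟨r, 2 * r, hr, by linarith⟩

variable {ε₀}

/-- `ε₀³ > 0`. [folklore] -/
theorem eps_cube_pos (hε : 0 < ε₀) : 0 < ε₀ ^ 3 := pow_pos hε 3

/-- **The magnitude cut-offs** `κⱼ`: smooth bumps around `|ξⱼ⁰|` equal to `1` within `2ε₀³` and
supported within `4ε₀³` (the magnitudes of the un-rotated frequencies, which lie in
`B(ξⱼ⁰, 2ε₀³)`). [cite: Tao2016AveragedNS, §3.6 p. 18] -/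
def kappaBump (hε : 0 < ε₀) (j : Fin 3) : ContDiffBump (‖xi0 j‖) :=
  bump2 (‖xi0 j‖) (r := 2 * ε₀ ^ 3) (by have := eps_cube_pos hε; linarith)

/-- **The frame cut-offs**: the direction of `ξ₃` within `ε₀³` of `ξ₃⁰/|ξ₃⁰| = (1,0,0)` and the unit
normal of the triangle within `ε₀³` of `(0,0,1)` — a `T³`-invariant form of Tao's restriction
(3.14) `|Rⱼξⱼ⁰ - ξⱼ⁰| < ε₀²/2` to rotations almost fixing `ξⱼ⁰`. [cite: Tao2016AveragedNS, §3.6 (3.14) p. 18] -/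
def dirBump (hε : 0 < ε₀) : ContDiffBump (ksE0 : ℝ³) :=
  bump2 ksE0 (r := ε₀ ^ 3 / 2) (by have := eps_cube_pos hε; linarith)

/-- The normal cut-off (see `dirBump`). [cite: Tao2016AveragedNS, §3.6 (3.14) p. 18] -/
def normalBump (hε : 0 < ε₀) : ContDiffBump (northVec : ℝ³) :=
  bump2 northVec (r := ε₀ ^ 3 / 2) (by have := eps_cube_pos hε; linarith)

/-- **The un-rotated frequency cut-offs** `χⱼ`: bumps around `ξⱼ⁰` equal to `1` on
`B̄(ξⱼ⁰, ε₀³) ⊇ supp ψ̂ⱼ` and supported in `B(ξⱼ⁰, 2ε₀³)`. [cite: Tao2016AveragedNS, §3.6 p. 18] -/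
def zetaBump (hε : 0 < ε₀) (j : Fin 3) : ContDiffBump (xi0 j) :=
  bump2 (xi0 j) (r := ε₀ ^ 3) (eps_cube_pos hε)

/-- The quaternion cut-off `∏ⱼ g₂(|qⱼ|²)` (smooth on all of `Q`, vanishing near `qⱼ = 0`). [folklore] -/
def qCut (q : ℍ × ℍ × ℍ) : ℝ := gBump2 (‖q.1‖ ^ 2) * gBump2 (‖q.2.1‖ ^ 2) * gBump2 (‖q.2.2‖ ^ 2)

/-- **The magnitude weight** `pRad(ξ) = |ξ₁||ξ₂||ξ₃| ∏ⱼ κⱼ(|ξⱼ|)` (the Jacobian factor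
`|ξ₁||ξ₂||ξ₃|` cancels the `(|ζ₁||ζ₂||ζ₃|)⁻¹` of the disintegration density). [cite: Tao2016AveragedNS, §3.6 p. 18] -/
def pRad (hε : 0 < ε₀) (p : ℝ³ × ℝ³) : ℝ :=
  (‖freq3 p 0‖ * ‖freq3 p 1‖ * ‖freq3 p 2‖) *
    ((kappaBump hε 0) ‖freq3 p 0‖ * (kappaBump hε 1) ‖freq3 p 1‖ * (kappaBump hε 2) ‖freq3 p 2‖)

/-- The unit normal of the frequency triangle. [cite: Tao2016AveragedNS, §3.8 p. 19] -/
def nVec (p : ℝ³ × ℝ³) : ℝ³ := gammaNormal (freq3 p)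

/-- `nVec p = (ξ₁ × ξ₂)/|ξ₁ × ξ₂|`. [folklore] -/
theorem nVec_eq (p : ℝ³ × ℝ³) : nVec p = udir (cross p.1 p.2) := rfl

/-- **The frame weight** `pFrame(ξ) = β₃(ξ₃/|ξ₃|) β_n(n(ξ))`. [cite: Tao2016AveragedNS, §3.6 (3.14) p. 18] -/
def pFrame (hε : 0 < ε₀) (p : ℝ³ × ℝ³) : ℝ := (dirBump hε) (udir (freq3 p 2)) * (normalBump hε) (nVec p)

/-- The un-rotated frequencies `ζⱼ = ρ(q̄ⱼ) ξⱼ` (`= rotFreq`). [cite: Tao2016AveragedNS, §3.5 p. 17] -/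
def zetaVec (q : ℍ × ℍ × ℍ) (p : ℝ³ × ℝ³) (j : Fin 3) : ℝ³ := qrotFun (star (slotQ q j)) (freq3 p j)

/-- `zetaVec` is `rotFreq` component-wise. [folklore] -/
theorem rotFreq_eq (q : ℍ × ℍ × ℍ) (p : ℝ³ × ℝ³) :
    rotFreq (q, p) = (zetaVec q p 0, zetaVec q p 1, zetaVec q p 2) := rfl

/-- The cut-off in the un-rotated frequencies `∏ⱼ χⱼ(ζⱼ)`. [cite: Tao2016AveragedNS, §3.6 p. 18] -/
def zCut (hε : 0 < ε₀) (q : ℍ × ℍ × ℍ) (p : ℝ³ × ℝ³) : ℝ :=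
  (zetaBump hε 0) (zetaVec q p 0) * (zetaBump hε 1) (zetaVec q p 1) * (zetaBump hε 2) (zetaVec q p 2)

/-- The radial quaternion profile `g(t) = g₀(t) g₂(t²)` of the disintegration, as `ℝ≥0∞`. [folklore] -/
def gTotal (t : ℝ) : ℝ≥0∞ := ENNReal.ofReal (gBump t * gBump2 (t ^ 2))

/-- The magnitude weight `R(r₁,r₂,r₃) = r₁r₂r₃ ∏ⱼ κⱼ(rⱼ)` of the disintegration, as `ℝ≥0∞`. [folklore] -/
def Rweight (hε : 0 < ε₀) (r₁ r₂ r₃ : ℝ) : ℝ≥0∞ :=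
  ENNReal.ofReal ((r₁ * r₂ * r₃) * ((kappaBump hε 0) r₁ * (kappaBump hε 1) r₂ * (kappaBump hε 2) r₃))

/-- The frame weight `B(e, m) = β₃(e) β_n(m)` of the disintegration, as `ℝ≥0∞`. [folklore] -/
def Bweight (hε : 0 < ε₀) (e m : ℝ³) : ℝ≥0∞ := ENNReal.ofReal ((dirBump hε) e * (normalBump hε) m)

/-- **The disintegration constant** `C = c_B · 2π c_K²` of `lintegral_rotation_disintegration` for
these weights. [cite: Tao2016AveragedNS, §3.6 p. 18] -/
def rotDensityConstE (hε : 0 < ε₀) : ℝ≥0∞ :=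
  frameConst gTotal (Bweight hε) * (ENNReal.ofReal (2 * π) * (ENNReal.ofReal (π / 4) * ksRadialConst gTotal) ^ 2)

/-- The disintegration constant as a real number. [cite: Tao2016AveragedNS, §3.6 p. 18] -/
def rotDensityConst (hε : 0 < ε₀) : ℝ := (rotDensityConstE hε).toReal

/-- **The real cut-off** of the joint weight: `qCut · pRad · pFrame · zCut / C`. [cite: Tao2016AveragedNS, §3.6 p. 18] -/
def realCut (hε : 0 < ε₀) (q : ℍ × ℍ × ℍ) (p : ℝ³ × ℝ³) : ℝ :=
  qCut q * pRad hε p * pFrame hε p * zCut hε q p * (rotDensityConst hε)⁻¹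

/-! #### The synthesis sum -/

/-- The isotropic frame vector `W^s_j(ξ)` of slot `j`. [cite: Tao2016AveragedNS, §3.8 p. 19] -/
def Wvec (p : ℝ³ × ℝ³) (j : Fin 3) (s : ℤˣ) : ℂ³ := frameW (freq3 p j) (nVec p) s

/-- `λ_σ(ξ)` for the frequency triangle. [cite: Tao2016AveragedNS, §3.9 p. 20] -/
def lamP (p : ℝ³ × ℝ³) (σ : Fin 3 → ℤˣ) : ℂ := lambdaSigma (freq3 p) (nVec p) σ

/-- The profile coefficient `aⱼ(ζ) = \overline{ψ̂ⱼ(ζ)}`. [cite: Tao2016AveragedNS, §3.5 p. 17] -/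
def aVec (j : Fin 3) (ζ : ℝ³) : ℂ³ := conj3 (𝓕 (⇑(ψ j)) ζ)

/-- The projection `P_ζ v = v - (v · u) u`, `u = ζ/|ζ| ⊗ 1`, onto `ζ^⊥ ⊗ ℂ` (along the axis). [folklore] -/
def projPerp (ζ : ℝ³) (v : ℂ³) : ℂ³ := v - cdot v (complexify (udir ζ)) • complexify (udir ζ)

/-- **The rotated, projected profile vector** `cⱼ(q, ξ) = (ρ(qⱼ) ⊗ 1) P_{ζⱼ} \overline{ψ̂ⱼ(ζⱼ)}`. [cite: Tao2016AveragedNS, §3.6 p. 18] -/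
def cVec (q : ℍ × ℍ × ℍ) (p : ℝ³ × ℝ³) (j : Fin 3) : ℂ³ :=
  rotMat (qrot (slotQ q j)) (projPerp (zetaVec q p j) (aVec ψ j (zetaVec q p j)))

/-- **The synthesis sum** `S(q, ξ) = Σ_σ λ_σ(ξ)⁻¹ ∏ⱼ (W^{σⱼ}ⱼ(ξ) · cⱼ(q, ξ))` (the weights
`F_σ`/`F''` of (3.21)–(3.23), contracted against `c₁ ⊗ c₂ ⊗ c₃`). [cite: Tao2016AveragedNS, §3.8 (3.21)–(3.23) p. 19] -/
def Ssum (q : ℍ × ℍ × ℍ) (p : ℝ³ × ℝ³) : ℂ :=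
  ∑ σ : Fin 3 → ℤˣ, (lamP p σ)⁻¹ * ∏ j, cdot (Wvec p j (σ j)) (cVec ψ q p j)

/-- **The joint weight on `Q × (ℝ³ × ℝ³)`**: `Fflat = realCut · Ssum` (Tao's `F̃'` in quaternion
coordinates). [cite: Tao2016AveragedNS, §3.6 (3.16) p. 18] -/
def Fflat (hε : 0 < ε₀) (q : ℍ × ℍ × ℍ) (p : ℝ³ × ℝ³) : ℂ := ((realCut hε q p : ℝ) : ℂ) * Ssum ψ q p

/-- **The joint weight `F` on `V × (ℝ³ × ℝ³)`.** [cite: Tao2016AveragedNS, §3.6 (3.16) p. 18] -/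
def jointF (hε : 0 < ε₀) (x : (Fin 4 → ℝ³) × (ℝ³ × ℝ³)) : ℂ := Fflat ψ hε (quatTripleEquiv x.1) x.2

end Weight
/-! ### Equivariance of the data under the angle actions -/

section Equivariance

variable {ε₀ : ℝ} (ψ : Fin 3 → 𝓢(ℝ³, ℂ³))

/-- `udir (udir v) = udir v` (`v ≠ 0`). [folklore] -/
theorem udir_udir {v : ℝ³} (hv : v ≠ 0) : udir (udir v) = udir v := by
  rw [udir, norm_udir hv, inv_one, one_smul]

/-- `R^θ_{u} = R^θ_v` for the unit axis `u = v/|v|`. [folklore] -/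
theorem rodRot_udir_axis {v : ℝ³} (hv : v ≠ 0) (θ : ℝ) (X : ℝ³) : rodRot (udir v) θ X = rodRot v θ X := by
  simp only [rodRot, udir_udir hv]

/-- Complexified rotations agree when the rotations agree pointwise. [folklore] -/
theorem rotMat_congr {R R' : ℝ³ ≃ₗᵢ[ℝ] ℝ³} (h : ∀ v, R v = R' v) (z : ℂ³) : rotMat R z = rotMat R' z := by
  rw [rotMat, complexifyCLM_eq_re_add_im, rotMat, complexifyCLM_eq_re_add_im]
  simp only [LinearIsometry.coe_toContinuousLinearMap, LinearIsometryEquiv.coe_toLinearIsometry, h]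

/-- The identity rotation complexifies to the identity. [folklore] -/
theorem rotMat_refl_apply (z : ℂ³) : rotMat (LinearIsometryEquiv.refl ℝ ℝ³) z = z := by
  rw [rotMat, complexifyCLM_eq_re_add_im]
  simp only [LinearIsometry.coe_toContinuousLinearMap, LinearIsometryEquiv.coe_toLinearIsometry,
    LinearIsometryEquiv.coe_refl, id_eq]
  exact complexify_re_add_I_smul_complexify_im z

/-- `\overline{e^{θu/2}} = e^{-θu/2}`. [folklore] -/
theorem star_quatExp (u : ℝ³) (θ : ℝ) : star (quatExp u θ) = quatExp u (-θ) := by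
  unfold quatExp
  rw [star_add, Quaternion.star_smul, star_quatOf, neg_div, Real.cos_neg, Real.sin_neg, smul_neg, neg_smul]
  congr 1
  ext <;> simp

/-- The angle action fixes its own axis: `ρ(\overline{e^{θu/2}}) v = v` for `u = v/|v|`. [folklore] -/
theorem qrotFun_star_quatExp_self {v : ℝ³} (hv : v ≠ 0) (θ : ℝ) : qrotFun (star (quatExp (udir v) θ)) v = v := by
  rw [star_quatExp, qrotFun_quatExp (norm_udir hv), rodRot_udir_axis hv, rodRot_axis]

/-- The un-rotated frequency is unchanged when the slot quaternion is multiplied on the left by a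
rotation about the frequency: `ρ(\overline{e q}) v = ρ(q̄) v` if `ρ(ē) v = v`. [folklore] -/
theorem qrotFun_star_mul_of_fix {e : ℍ} (q : ℍ) {v : ℝ³} (hev : qrotFun (star e) v = v) :
    qrotFun (star (e * q)) v = qrotFun (star q) v := by
  rw [star_mul, qrotFun_mul, hev]

/-- Composition of complexified rotations follows composition of the rotations. [folklore] -/
theorem rotMat_eq_rotMat_rotMat (R R₁ R₂ : ℝ³ ≃ₗᵢ[ℝ] ℝ³) (h : ∀ v, R v = R₁ (R₂ v)) (z : ℂ³) :
    rotMat R z = rotMat R₁ (rotMat R₂ z) := by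
  rw [rotMat, complexifyCLM_eq_re_add_im, rotMat, rotMat]
  simp only [LinearIsometry.coe_toContinuousLinearMap, LinearIsometryEquiv.coe_toLinearIsometry, h]
  rw [← rotMat_complexify R₁, ← rotMat_complexify R₁, ← rotMat_complexify R₂, ← rotMat_complexify R₂, ← map_smul,
    ← map_smul, ← map_add, ← map_add, complexify_re_add_I_smul_complexify_im]

/-- `ρ(e q) ⊗ 1 = (ρ(e) ⊗ 1)(ρ(q) ⊗ 1)` (`e, q ≠ 0`). [folklore] -/
theorem rotMat_qrot_mul {e q : ℍ} (he : e ≠ 0) (hq : q ≠ 0) (z : ℂ³) :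
    rotMat (qrot (e * q)) z = rotMat (qrot e) (rotMat (qrot q) z) :=
  rotMat_eq_rotMat_rotMat _ _ _ (fun v => qrot_mul_apply he hq v) z

/-- The angle action is the rotation `R^θ_v ⊗ 1` on `ℂ³`. [cite: Tao2016AveragedNS, §3.7 footnote 6 p. 19] -/
theorem rotMat_qrot_quatExp {v : ℝ³} (hv : v ≠ 0) (θ : ℝ) (z : ℂ³) :
    rotMat (qrot (quatExp (udir v) θ)) z = rotMat (rodRotEquiv hv θ) z :=
  rotMat_congr (fun w => by rw [qrot_quatExp (norm_udir hv), rodRot_udir_axis hv, rodRotEquiv_apply]) z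

/-- **The frame coefficients rotate by characters**: `W^s · (R^θ ⊗ 1) c = e^{-isθ} (W^s · c)`. [cite: Tao2016AveragedNS, §3.8 p. 19] -/
theorem cdot_frameW_rotMat_rodRotEquiv {ξ n : ℝ³} (hξ : ξ ≠ 0) (hn : ⟪n, ξ⟫ = 0) (θ : ℝ) (s : ℤˣ) (c : ℂ³) :
    cdot (frameW ξ n s) (rotMat (rodRotEquiv hξ θ) c) =
      Complex.exp (-(Complex.I * ((s : ℤ) : ℂ) * (θ : ℂ))) * cdot (frameW ξ n s) c := by
  -- `W = R^θ (R^{-θ} W)` and `R^{-θ} W = e^{-isθ} W`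
  have hgrp : rotMat (rodRotEquiv hξ θ) (rotMat (rodRotEquiv hξ (-θ)) (frameW ξ n s)) = frameW ξ n s := by
    rw [← rotMat_eq_rotMat_rotMat (LinearIsometryEquiv.refl ℝ ℝ³) (rodRotEquiv hξ θ) (rodRotEquiv hξ (-θ)),
      rotMat_refl_apply]
    intro v
    rw [rodRotEquiv_apply, rodRotEquiv_apply, rodRot_rodRot hξ, add_neg_cancel, rodRot_zero]
    rfl
  conv_lhs => rw [← hgrp]
  rw [cdot_complexifyCLM, rotMat_rodRotEquiv_frameW hξ hn (-θ) s, cdot_smul_left]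
  congr 1
  push_cast
  ring_nf

end Equivariance
/-! ### The localisation lemma: on the support of the cut-offs the triangle is near (3.7) -/

section Localisation

variable {ε₀ : ℝ}

/-- A bump function is non-zero only within its outer radius. [folklore] -/
theorem bump_dist_lt_of_ne_zero {X : Type*} [NormedAddCommGroup X] [NormedSpace ℝ X] [HasContDiffBump X]
    {c : X} (f : ContDiffBump c) {x : X} (hx : f x ≠ 0) : dist x c < f.rOut := by
  have : x ∈ Function.support (f : X → ℝ) := hx
  rw [ContDiffBump.support_eq] at this
  exact Metric.mem_ball.mp this

/-- `|a × b| ≤ |a| |b|` (also proved, for the same `cross`, as `FluidPDE.norm_cross_le` in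
`PoincareHomotopyOperatorL2.lean`, which is not imported here to keep the import graph light). [folklore] -/
theorem norm_cross_le_norm_mul (a b : ℝ³) : ‖cross a b‖ ≤ ‖a‖ * ‖b‖ := by
  rw [norm_cross]
  have h1 : Real.sin (InnerProductGeometry.angle a b) ≤ 1 := Real.sin_le_one _
  have h2 : 0 ≤ ‖a‖ * ‖b‖ := by positivity
  nlinarith

/-- The outer radii of the cut-offs. [folklore] -/
theorem kappaBump_rOut (hε : 0 < ε₀) (j : Fin 3) : (kappaBump hε j).rOut = 4 * ε₀ ^ 3 := by
  show 2 * (2 * ε₀ ^ 3) = 4 * ε₀ ^ 3; ring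

/-- The outer radii of the cut-offs. [folklore] -/
theorem dirBump_rOut (hε : 0 < ε₀) : (dirBump hε).rOut = ε₀ ^ 3 := by
  show 2 * (ε₀ ^ 3 / 2) = ε₀ ^ 3; ring

/-- The outer radii of the cut-offs. [folklore] -/
theorem normalBump_rOut (hε : 0 < ε₀) : (normalBump hε).rOut = ε₀ ^ 3 := by
  show 2 * (ε₀ ^ 3 / 2) = ε₀ ^ 3; ring

/-- The outer radii of the cut-offs. [folklore] -/
theorem zetaBump_rOut (hε : 0 < ε₀) (j : Fin 3) : (zetaBump hε j).rOut = 2 * ε₀ ^ 3 := rfl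

/-- The inner radii of the cut-offs. [folklore] -/
theorem zetaBump_rIn (hε : 0 < ε₀) (j : Fin 3) : (zetaBump hε j).rIn = ε₀ ^ 3 := rfl

/-- The inner radii of the cut-offs. [folklore] -/
theorem kappaBump_rIn (hε : 0 < ε₀) (j : Fin 3) : (kappaBump hε j).rIn = 2 * ε₀ ^ 3 := rfl

/-- `ξ₃⁰ = (1,0,0) = e₀`. [cite: Tao2016AveragedNS, (3.7)] -/
theorem xi0_two_eq_ksE0 : xi0 2 = ksE0 := by
  ext i; fin_cases i <;> simp [xi0, ksE0]

/-- `e₀ × (0,0,1) = -ξ₁⁰`: the reference frame reconstructs (3.7). [cite: Tao2016AveragedNS, (3.7)] -/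
theorem cross_ksE0_northVec : cross ksE0 northVec = -xi0 0 := by
  ext i
  fin_cases i <;> simp [cross_apply_zero, cross_apply_one, cross_apply_two, ksE0, northVec, xi0]

/-- **Magnitudes on the support of `pRad`**: each `|ξⱼ|` is within `4ε₀³` of `|ξⱼ⁰|` and non-zero. [cite: Tao2016AveragedNS, §3.6 p. 18] -/
theorem radii_of_pRad_ne_zero (hε : 0 < ε₀) {p : ℝ³ × ℝ³} (h : pRad hε p ≠ 0) (j : Fin 3) :
    |‖freq3 p j‖ - ‖xi0 j‖| < 4 * ε₀ ^ 3 ∧ freq3 p j ≠ 0 := by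
  unfold pRad at h
  simp only [mul_ne_zero_iff] at h
  obtain ⟨⟨⟨n0, n1⟩, n2⟩, ⟨⟨k0, k1⟩, k2⟩⟩ := h
  have hk : (kappaBump hε j) ‖freq3 p j‖ ≠ 0 := by
    fin_cases j
    · exact k0
    · exact k1
    · exact k2
  have hn : ‖freq3 p j‖ ≠ 0 := by
    fin_cases j
    · exact n0
    · exact n1
    · exact n2
  refine ⟨?_, norm_ne_zero_iff.mp hn⟩
  have := bump_dist_lt_of_ne_zero (kappaBump hε j) hk
  rwa [kappaBump_rOut, Real.dist_eq] at this

/-- **Frame on the support of `pFrame`**: the direction of `ξ₃` and the normal are within `ε₀³`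
of `e₀`, `(0,0,1)`. [cite: Tao2016AveragedNS, §3.6 (3.14) p. 18] -/
theorem frame_of_pFrame_ne_zero (hε : 0 < ε₀) {p : ℝ³ × ℝ³} (h : pFrame hε p ≠ 0) :
    ‖udir (freq3 p 2) - ksE0‖ < ε₀ ^ 3 ∧ ‖nVec p - northVec‖ < ε₀ ^ 3 := by
  unfold pFrame at h
  have h1 : (dirBump hε) (udir (freq3 p 2)) ≠ 0 := left_ne_zero_of_mul h
  have h2 : (normalBump hε) (nVec p) ≠ 0 := right_ne_zero_of_mul h
  have d1 := bump_dist_lt_of_ne_zero (dirBump hε) h1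
  have d2 := bump_dist_lt_of_ne_zero (normalBump hε) h2
  rw [dirBump_rOut, dist_eq_norm] at d1
  rw [normalBump_rOut, dist_eq_norm] at d2
  exact ⟨d1, d2⟩

/-- Pure arithmetic of the magnitudes near `(1, √2, 1)`. [folklore] -/
theorem radii_estimates {t r₁ r₂ r₃ : ℝ} (ht0 : 0 < t) (ht1 : t ≤ 1 / 1000)
    (h1 : |r₁ - 1| < 4 * t) (h2 : |r₂ - Real.sqrt 2| < 4 * t) (h3 : |r₃ - 1| < 4 * t) :
    |(r₂ ^ 2 - r₁ ^ 2 - r₃ ^ 2) / 2| ≤ 15 * t ∧ 1 / 2 ≤ r₃ ∧ r₃ ≤ 2 ∧ 1 / 2 ≤ r₁ ∧ r₁ ≤ 2 ∧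
      |1 - r₁ ^ 2| ≤ 9 * t := by
  have hs : (1.41 : ℝ) < Real.sqrt 2 ∧ Real.sqrt 2 < 1.42 := by
    constructor
    · rw [show (1.41 : ℝ) = Real.sqrt (1.41 ^ 2) by rw [Real.sqrt_sq (by norm_num)]]
      exact Real.sqrt_lt_sqrt (by norm_num) (by norm_num)
    · rw [show (1.42 : ℝ) = Real.sqrt (1.42 ^ 2) by rw [Real.sqrt_sq (by norm_num)]]
      exact Real.sqrt_lt_sqrt (by norm_num) (by norm_num)
  have hsq : Real.sqrt 2 ^ 2 = 2 := Real.sq_sqrt (by norm_num)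
  obtain ⟨h1a, h1b⟩ := abs_lt.mp h1
  obtain ⟨h2a, h2b⟩ := abs_lt.mp h2
  obtain ⟨h3a, h3b⟩ := abs_lt.mp h3
  -- squares
  have q1 : |1 - r₁ ^ 2| ≤ 9 * t := by
    rw [abs_le]; constructor <;> nlinarith
  have q3 : |1 - r₃ ^ 2| ≤ 9 * t := by
    rw [abs_le]; constructor <;> nlinarith
  have q2 : |r₂ ^ 2 - 2| ≤ 12 * t := by
    rw [abs_le]; constructor <;> nlinarith
  refine ⟨?_, by linarith, by linarith, by linarith, by linarith, q1⟩
  rw [abs_le]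
  obtain ⟨q1a, q1b⟩ := abs_le.mp q1
  obtain ⟨q2a, q2b⟩ := abs_le.mp q2
  obtain ⟨q3a, q3b⟩ := abs_le.mp q3
  constructor <;> linarith

/-- `ξ₁ · (e × n) = -|ξ₃ × ξ₁| / |ξ₃|` for `e = ξ₃/|ξ₃|`, `n = (ξ₃ × ξ₁)/|ξ₃ × ξ₁|`: the second frame
coordinate of `ξ₁` is negative and given by the side lengths. [folklore] -/
theorem inner_cross_frame_eq {p₁ p₃ : ℝ³} (hp₃ : p₃ ≠ 0) (hc : cross p₃ p₁ ≠ 0) :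
    ⟪p₁, cross (udir p₃) (udir (cross p₃ p₁))⟫ = -(‖cross p₃ p₁‖ / ‖p₃‖) := by
  have hr : ‖p₃‖ ≠ 0 := norm_ne_zero_iff.mpr hp₃
  have hcn : ‖cross p₃ p₁‖ ≠ 0 := norm_ne_zero_iff.mpr hc
  rw [udir, udir, cross_smul_left, cross_smul_right, real_inner_smul_right, real_inner_smul_right,
    cross_cross_eq_smul_sub, inner_sub_right, real_inner_smul_right, real_inner_smul_right,
    real_inner_self_eq_norm_sq, real_inner_self_eq_norm_sq, real_inner_comm p₁ p₃]
  have hlag : ‖cross p₃ p₁‖ ^ 2 = ‖p₃‖ ^ 2 * ‖p₁‖ ^ 2 - ⟪p₁, p₃⟫ ^ 2 := by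
    rw [norm_cross_sq, real_inner_comm p₁ p₃]
  field_simp
  nlinarith [hlag]

/-- `ξ₁ × ξ₂ = ξ₃ × ξ₁` for a closed triangle. [folklore] -/
theorem cross_eq_cross_close (p₁ p₂ : ℝ³) : cross p₁ p₂ = cross (-p₁ - p₂) p₁ := by
  ext i
  fin_cases i <;> simp [cross_apply_zero, cross_apply_one, cross_apply_two] <;> ring

/-- Step A of the localisation: `ξ₃` from its magnitude and direction. [folklore] -/
theorem near_xi0_two_of_frame {t : ℝ} {v : ℝ³} (hv : v ≠ 0) (hr : |‖v‖ - 1| < 4 * t)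
    (he : ‖udir v - ksE0‖ < t) : ‖v - xi0 2‖ ≤ 5 * t := by
  have he1 : ‖udir v‖ = 1 := norm_udir hv
  have e3 : v - xi0 2 = (‖v‖ - 1) • udir v + (udir v - ksE0) := by
    rw [xi0_two_eq_ksE0, sub_smul, one_smul, ← eq_norm_smul_udir hv]; abel
  rw [e3]
  calc _ ≤ ‖(‖v‖ - 1) • udir v‖ + ‖udir v - ksE0‖ := norm_add_le _ _
    _ = |‖v‖ - 1| * 1 + ‖udir v - ksE0‖ := by rw [norm_smul, Real.norm_eq_abs, he1]
    _ ≤ 4 * t * 1 + t := add_le_add (by rw [mul_one, mul_one]; exact hr.le) he.le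
    _ = 5 * t := by ring

/-- The arithmetic of the second frame coordinate. [folklore] -/
theorem gamma_estimate {t r₁ r₃ nc ip : ℝ} (ht0 : 0 < t) (ht1 : t ≤ 1 / 1000) (hr3 : |r₃ - 1| < 4 * t)
    (hq1 : |1 - r₁ ^ 2| ≤ 9 * t) (hip : |ip| ≤ 15 * t) (hnc : 0 < nc)
    (hlag : nc ^ 2 = r₃ ^ 2 * r₁ ^ 2 - ip ^ 2) : |-(nc / r₃) + 1| ≤ 50 * t := by
  obtain ⟨h3a, h3b⟩ := abs_lt.mp hr3
  obtain ⟨qa, qb⟩ := abs_le.mp hq1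
  have hip2 : ip ^ 2 ≤ (15 * t) ^ 2 := by
    rw [← sq_abs]; exact pow_le_pow_left₀ (abs_nonneg ip) hip 2
  have hr₃pos : 1 / 2 < r₃ := by linarith
  have hr₃hi : r₃ < 1 + 4 * t := by linarith
  have hr3sq : r₃ ^ 2 ≤ 1.01 := by nlinarith
  have h1 : |r₃ ^ 2 - nc ^ 2| ≤ 11 * t := by
    rw [hlag, show r₃ ^ 2 - (r₃ ^ 2 * r₁ ^ 2 - ip ^ 2) = r₃ ^ 2 * (1 - r₁ ^ 2) + ip ^ 2 by ring, abs_le]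
    have hA : |r₃ ^ 2 * (1 - r₁ ^ 2)| ≤ 1.01 * (9 * t) := by
      rw [abs_mul, abs_of_nonneg (sq_nonneg r₃)]
      exact mul_le_mul hr3sq hq1 (abs_nonneg _) (by norm_num)
    obtain ⟨hA1, hA2⟩ := abs_le.mp hA
    have ht2 : (15 * t) ^ 2 ≤ t := by nlinarith
    constructor <;> nlinarith [sq_nonneg ip]
  have h2 : |r₃ - nc| * (r₃ + nc) = |r₃ ^ 2 - nc ^ 2| := by
    rw [show r₃ ^ 2 - nc ^ 2 = (r₃ - nc) * (r₃ + nc) by ring, abs_mul, abs_of_pos (by linarith : 0 < r₃ + nc)]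
  have h3 : |r₃ - nc| ≤ 22 * t := by
    have : |r₃ - nc| * (1 / 2) ≤ 11 * t := by
      calc |r₃ - nc| * (1 / 2) ≤ |r₃ - nc| * (r₃ + nc) := by gcongr; linarith
        _ = |r₃ ^ 2 - nc ^ 2| := h2
        _ ≤ 11 * t := h1
    linarith
  rw [show -(nc / r₃) + 1 = (r₃ - nc) / r₃ by field_simp; ring, abs_div, abs_of_pos (by linarith : (0 : ℝ) < r₃),
    div_le_iff₀ (by linarith : (0 : ℝ) < r₃)]
  nlinarith [abs_nonneg (r₃ - nc)]

/-- Step B of the localisation: `ξ₁` from its frame coordinates. [folklore] -/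
theorem near_xi0_zero_of_frame {t : ℝ} {p₁ e m : ℝ³} (he1 : ‖e‖ = 1) (hm1 : ‖m‖ = 1)
    (hexp : p₁ = ⟪p₁, e⟫ • e + ⟪p₁, cross e m⟫ • cross e m)
    (hα : |⟪p₁, e⟫| ≤ 30 * t) (hγ : |⟪p₁, cross e m⟫ + 1| ≤ 50 * t)
    (he : ‖e - ksE0‖ < t) (hm : ‖m - northVec‖ < t) : ‖p₁ - xi0 0‖ ≤ 82 * t := by
  have hx0 : xi0 0 = -cross ksE0 northVec := by rw [cross_ksE0_northVec, neg_neg]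
  have hc1 : cross (e - ksE0) m = cross e m - cross ksE0 m := by
    ext i; fin_cases i <;> simp [cross_apply_zero, cross_apply_one, cross_apply_two] <;> ring
  have hc2 : cross ksE0 (m - northVec) = cross ksE0 m - cross ksE0 northVec := by
    ext i; fin_cases i <;> simp [cross_apply_zero, cross_apply_one, cross_apply_two] <;> ring
  have e1 : p₁ - xi0 0 = ⟪p₁, e⟫ • e + (⟪p₁, cross e m⟫ + 1) • cross e m -
      (cross (e - ksE0) m + cross ksE0 (m - northVec)) := by
    conv_lhs => rw [hexp, hx0]
    rw [hc1, hc2, add_smul, one_smul]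
    abel
  rw [e1]
  calc _ ≤ ‖⟪p₁, e⟫ • e + (⟪p₁, cross e m⟫ + 1) • cross e m‖ + ‖cross (e - ksE0) m + cross ksE0 (m - northVec)‖ :=
        norm_sub_le _ _
    _ ≤ (‖⟪p₁, e⟫ • e‖ + ‖(⟪p₁, cross e m⟫ + 1) • cross e m‖) + (‖cross (e - ksE0) m‖ + ‖cross ksE0 (m - northVec)‖) :=
        add_le_add (norm_add_le _ _) (norm_add_le _ _)
    _ = |⟪p₁, e⟫| * ‖e‖ + |⟪p₁, cross e m⟫ + 1| * ‖cross e m‖ + (‖cross (e - ksE0) m‖ + ‖cross ksE0 (m - northVec)‖) := by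
        rw [norm_smul, norm_smul, Real.norm_eq_abs, Real.norm_eq_abs]
    _ ≤ 30 * t * 1 + 50 * t * 1 + (t * 1 + 1 * t) := by
        have hem : ‖cross e m‖ ≤ 1 := by
          calc ‖cross e m‖ ≤ ‖e‖ * ‖m‖ := norm_cross_le_norm_mul _ _
            _ = 1 := by rw [he1, hm1, one_mul]
        have h3 : ‖cross (e - ksE0) m‖ ≤ t * 1 := by
          calc ‖cross (e - ksE0) m‖ ≤ ‖e - ksE0‖ * ‖m‖ := norm_cross_le_norm_mul _ _
            _ ≤ t * 1 := by rw [hm1]; exact mul_le_mul_of_nonneg_right he.le zero_le_one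
        have h4 : ‖cross ksE0 (m - northVec)‖ ≤ 1 * t := by
          calc ‖cross ksE0 (m - northVec)‖ ≤ ‖ksE0‖ * ‖m - northVec‖ := norm_cross_le_norm_mul _ _
            _ ≤ 1 * t := by rw [norm_ksE0]; exact mul_le_mul_of_nonneg_left hm.le zero_le_one
        have h1 : |⟪p₁, e⟫| * ‖e‖ ≤ 30 * t * 1 := by rw [he1]; exact mul_le_mul_of_nonneg_right hα zero_le_one
        have h2 : |⟪p₁, cross e m⟫ + 1| * ‖cross e m‖ ≤ 50 * t * 1 :=
          mul_le_mul hγ hem (norm_nonneg _) (by linarith [abs_nonneg (⟪p₁, cross e m⟫ + 1)])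
        linarith
    _ = 82 * t := by ring

/-- **The localisation lemma.** If `ε₀ ≤ 1/10` and the magnitude and frame cut-offs do not vanish
at `ξ = (ξ₁, ξ₂)`, then the closed triangle `(ξ₁, ξ₂, ξ₃)` is within `100 ε₀³` of the normalised
configuration (3.7): `|ξⱼ - ξⱼ⁰| ≤ 100 ε₀³` for `j = 1,2,3`.  (Reconstruction of a triangle from its
side lengths, the direction of one side and its unit normal: `ξ₃ = |ξ₃| e`,
`ξ₁ = (ξ₁·e) e + (ξ₁·(e×n)) (e×n)` with `ξ₁·e = (|ξ₂|²-|ξ₁|²-|ξ₃|²)/(2|ξ₃|)` and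
`ξ₁·(e×n) = -|ξ₃ × ξ₁|/|ξ₃|`.)  This is what makes Tao's weight `φ η` identically `1` on the support
((3.14): "the weight … is equal to one (for `ε₀` small enough)") and puts `ξ` in the range of
the non-degeneracy (3.24). [cite: Tao2016AveragedNS, §3.6 (3.14) p. 18] -/
theorem near_xi0_of_cutoffs (hε : 0 < ε₀) (hε1 : ε₀ ≤ 1 / 10) {p : ℝ³ × ℝ³}
    (hR : pRad hε p ≠ 0) (hB : pFrame hε p ≠ 0) : ∀ j, ‖freq3 p j - xi0 j‖ ≤ 100 * ε₀ ^ 3 := by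
  have ht0 : 0 < ε₀ ^ 3 := eps_cube_pos hε
  have ht1 : ε₀ ^ 3 ≤ 1 / 1000 := by
    calc ε₀ ^ 3 ≤ (1 / 10) ^ 3 := by gcongr
      _ = 1 / 1000 := by norm_num
  obtain ⟨p₁, p₂⟩ := p
  -- data on the support
  obtain ⟨hr1, hp₁0⟩ := radii_of_pRad_ne_zero hε hR 0
  obtain ⟨hr2, -⟩ := radii_of_pRad_ne_zero hε hR 1
  obtain ⟨hr3, hp₃0⟩ := radii_of_pRad_ne_zero hε hR 2
  rw [freq3_zero, norm_xi0_zero] at hr1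
  rw [freq3_one, norm_xi0_one] at hr2
  rw [freq3_two, norm_xi0_two] at hr3
  rw [freq3_zero] at hp₁0
  rw [freq3_two] at hp₃0
  obtain ⟨he, hm⟩ := frame_of_pFrame_ne_zero hε hB
  rw [freq3_two] at he
  -- the frame
  have hm0 : cross p₁ p₂ ≠ 0 := by
    intro h0
    have : nVec (p₁, p₂) = 0 := by rw [nVec_eq, h0, udir, norm_zero, inv_zero, zero_smul]
    rw [this, zero_sub, norm_neg, norm_northVec] at hm
    linarith
  have hc0 : cross (-p₁ - p₂) p₁ ≠ 0 := by rw [← cross_eq_cross_close]; exact hm0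
  have hmn : nVec (p₁, p₂) = udir (cross (-p₁ - p₂) p₁) := by rw [nVec_eq, cross_eq_cross_close]
  have hm1 : ‖nVec (p₁, p₂)‖ = 1 := by rw [hmn]; exact norm_udir hc0
  have he1 : ‖udir (-p₁ - p₂)‖ = 1 := norm_udir hp₃0
  have hm_p₁ : ⟪nVec (p₁, p₂), p₁⟫ = 0 := inner_gammaNormal_zero (freq3 (p₁, p₂))
  have hm_p₃ : ⟪nVec (p₁, p₂), -p₁ - p₂⟫ = 0 := inner_gammaNormal_two (freq3_sum (p₁, p₂))
  -- arithmetic of the side lengths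
  obtain ⟨hip, hr₃lo, -, -, -, hq1⟩ := radii_estimates ht0 ht1 hr1 hr2 hr3
  have hlaw : ⟪p₁, -p₁ - p₂⟫ = (‖p₂‖ ^ 2 - ‖p₁‖ ^ 2 - ‖-p₁ - p₂‖ ^ 2) / 2 := by
    have h2 : ‖p₂‖ = ‖p₁ + (-p₁ - p₂)‖ := by
      rw [show p₁ + (-p₁ - p₂) = -p₂ by abel, norm_neg]
    have : ‖p₂‖ ^ 2 = ‖p₁‖ ^ 2 + 2 * ⟪p₁, -p₁ - p₂⟫ + ‖-p₁ - p₂‖ ^ 2 := by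
      rw [h2, ← real_inner_self_eq_norm_sq, inner_add_left, inner_add_right, inner_add_right,
        real_inner_self_eq_norm_sq, real_inner_self_eq_norm_sq, real_inner_comm (-p₁ - p₂) p₁]
      ring
    linarith
  have hip' : |⟪p₁, -p₁ - p₂⟫| ≤ 15 * ε₀ ^ 3 := by rw [hlaw]; exact hip
  -- Step A
  have hA : ‖(-p₁ - p₂) - xi0 2‖ ≤ 5 * ε₀ ^ 3 := near_xi0_two_of_frame hp₃0 hr3 he
  -- Step B
  have hα : |⟪p₁, udir (-p₁ - p₂)⟫| ≤ 30 * ε₀ ^ 3 := by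
    rw [inner_udir_right, abs_mul, abs_inv, abs_of_pos (by linarith)]
    rw [inv_mul_le_iff₀ (by linarith)]
    calc |⟪p₁, -p₁ - p₂⟫| ≤ 15 * ε₀ ^ 3 := hip'
      _ ≤ ‖-p₁ - p₂‖ * (30 * ε₀ ^ 3) := by nlinarith
  have hγ : |⟪p₁, cross (udir (-p₁ - p₂)) (nVec (p₁, p₂))⟫ + 1| ≤ 50 * ε₀ ^ 3 := by
    rw [hmn, inner_cross_frame_eq hp₃0 hc0]
    have hlag : ‖cross (-p₁ - p₂) p₁‖ ^ 2 = ‖-p₁ - p₂‖ ^ 2 * ‖p₁‖ ^ 2 - ⟪p₁, -p₁ - p₂⟫ ^ 2 := by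
      rw [norm_cross_sq, real_inner_comm p₁ (-p₁ - p₂)]
    exact gamma_estimate ht0 ht1 hr3 hq1 hip' (norm_pos_iff.mpr hc0) hlag
  have hexp : p₁ = ⟪p₁, udir (-p₁ - p₂)⟫ • udir (-p₁ - p₂) +
      ⟪p₁, cross (udir (-p₁ - p₂)) (nVec (p₁, p₂))⟫ • cross (udir (-p₁ - p₂)) (nVec (p₁, p₂)) := by
    have h := real_frame_expansion hp₃0 hm1 hm_p₃ p₁
    rw [real_inner_comm (nVec (p₁, p₂)) p₁, hm_p₁, zero_smul, add_zero] at h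
    exact h
  have hBstep : ‖p₁ - xi0 0‖ ≤ 82 * ε₀ ^ 3 := near_xi0_zero_of_frame he1 hm1 hexp hα hγ he hm
  -- Step C: `ξ₂ = -ξ₁ - ξ₃`
  have hCstep : ‖p₂ - xi0 1‖ ≤ 87 * ε₀ ^ 3 := by
    have hxi : xi0 1 = -xi0 0 - xi0 2 := by
      have h := xi0_sum
      calc xi0 1 = (xi0 0 + xi0 1 + xi0 2) - xi0 0 - xi0 2 := by abel
        _ = -xi0 0 - xi0 2 := by rw [h]; abel
    have : p₂ - xi0 1 = -(p₁ - xi0 0) - ((-p₁ - p₂) - xi0 2) := by rw [hxi]; abel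
    rw [this]
    calc _ ≤ ‖-(p₁ - xi0 0)‖ + ‖(-p₁ - p₂) - xi0 2‖ := norm_sub_le _ _
      _ ≤ 82 * ε₀ ^ 3 + 5 * ε₀ ^ 3 := by rw [norm_neg]; exact add_le_add hBstep hA
      _ = 87 * ε₀ ^ 3 := by ring
  intro j
  fin_cases j
  · exact hBstep.trans (by linarith)
  · exact hCstep.trans (by linarith)
  · exact hA.trans (by linarith)

end Localisation
open scoped ContDiff
/-! ### The disintegration constant is positive and finite -/

section Constants

variable {ε₀ : ℝ}

/-- `g(t) ≤ 1`. [folklore] -/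
theorem gTotal_le_one (t : ℝ) : gTotal t ≤ 1 :=
  ENNReal.ofReal_le_one.mpr (mul_le_one₀ gBump.le_one gBump2.nonneg gBump2.le_one)

/-- `g(t) = 0` for `t > 3/2`. [folklore] -/
theorem gTotal_eq_zero_of_lt {t : ℝ} (ht : (3 / 2 : ℝ) < t) : gTotal t = 0 := by
  have : (gBump : ℝ → ℝ) t = 0 :=
    gBump.zero_of_le_dist (by rw [Real.dist_eq, gBump]; rw [abs_of_pos (by linarith)]; linarith)
  rw [gTotal, this, zero_mul, ENNReal.ofReal_zero]

/-- `g(t) = 0` for `t < 1/2`. [folklore] -/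
theorem gTotal_eq_zero_of_lt' {t : ℝ} (ht : t < (1 / 2 : ℝ)) : gTotal t = 0 := by
  have : (gBump : ℝ → ℝ) t = 0 :=
    gBump.zero_of_le_dist (by rw [Real.dist_eq, gBump]; rw [abs_of_neg (by linarith)]; linarith)
  rw [gTotal, this, zero_mul, ENNReal.ofReal_zero]

/-- `g(t) = 1` for `t ∈ [4/5, 6/5]` (then `|t - 1| ≤ 1/4` and `|t² - 1| ≤ 1/2`). [folklore] -/
theorem gTotal_eq_one {t : ℝ} (h1 : (4 / 5 : ℝ) ≤ t) (h2 : t ≤ (6 / 5 : ℝ)) : gTotal t = 1 := by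
  have h1' : |t - 1| ≤ 1 / 4 := by rw [abs_le]; constructor <;> linarith
  have h2' : |t ^ 2 - 1| ≤ 1 / 2 := by rw [abs_le]; constructor <;> nlinarith
  have e1 : (gBump : ℝ → ℝ) t = 1 :=
    gBump.one_of_mem_closedBall (by rw [Metric.mem_closedBall, Real.dist_eq]; exact h1')
  have e2 : (gBump2 : ℝ → ℝ) (t ^ 2) = 1 :=
    gBump2.one_of_mem_closedBall (by rw [Metric.mem_closedBall, Real.dist_eq]; exact h2')
  rw [gTotal, e1, e2, one_mul, ENNReal.ofReal_one]

/-- The measurability of `g`. [folklore] -/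
theorem measurable_gTotal : Measurable gTotal :=
  ENNReal.measurable_ofReal.comp
    ((gBump.continuous.mul (gBump2.continuous.comp (continuous_id.pow 2))).measurable)

/-- `B ≤ 1`. [folklore] -/
theorem Bweight_le_one (hε : 0 < ε₀) (e m : ℝ³) : Bweight hε e m ≤ 1 :=
  ENNReal.ofReal_le_one.mpr (mul_le_one₀ (dirBump hε).le_one (normalBump hε).nonneg (normalBump hε).le_one)

/-- The measurability of `B`. [folklore] -/
theorem measurable_Bweight (hε : 0 < ε₀) : Measurable (Function.uncurry (Bweight hε)) :=
  ENNReal.measurable_ofReal.comp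
    (((dirBump hε).continuous.comp continuous_fst).mul ((normalBump hε).continuous.comp continuous_snd)).measurable

/-- **`c_B < ∞`.** [folklore] -/
theorem frameConst_lt_top (hε : 0 < ε₀) : frameConst gTotal (Bweight hε) < ⊤ := by
  unfold frameConst
  set K : Set ℍ := Metric.closedBall 0 2
  have hle : (fun a : ℍ => gTotal ‖a‖ * Bweight hε (qrotFun a ksE0) (qrotFun a northVec)) ≤ K.indicator fun _ => (1 : ℝ≥0∞) := by
    intro a
    show gTotal ‖a‖ * Bweight hε (qrotFun a ksE0) (qrotFun a northVec) ≤ _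
    by_cases ha : a ∈ K
    · rw [indicator_of_mem ha]
      exact mul_le_one' (gTotal_le_one _) (Bweight_le_one hε _ _)
    · have : (3 / 2 : ℝ) < ‖a‖ := by
        simp only [K, Metric.mem_closedBall, dist_zero_right, not_le] at ha; linarith
      rw [gTotal_eq_zero_of_lt this, zero_mul]; exact zero_le
  calc _ ≤ ∫⁻ a, K.indicator (fun _ => (1 : ℝ≥0∞)) a := lintegral_mono hle
    _ = volume K := by rw [lintegral_indicator measurableSet_closedBall, setLIntegral_const, one_mul]
    _ < ⊤ := (isCompact_closedBall (0 : ℍ) 2).measure_lt_top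

/-- **`c_B > 0`**: near `a = 1` the integrand is `1`. [folklore] -/
theorem frameConst_pos (hε : 0 < ε₀) : 0 < frameConst gTotal (Bweight hε) := by
  unfold frameConst
  -- continuity of `a ↦ ρ(a) e₀`, `a ↦ ρ(a) n⁰` at `a = 1`
  have hr : 0 < ε₀ ^ 3 / 2 := by have := eps_cube_pos hε; linarith
  have hc : ∀ v : ℝ³, ∃ δ > 0, ∀ a : ℍ, dist a 1 < δ → ‖qrotFun a v - v‖ < ε₀ ^ 3 / 2 := by
    intro v
    have h' : ContinuousAt (fun a : ℍ => qrotFun a v) 1 := continuousAt_qrotFun one_ne_zero v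
    have := Metric.continuousAt_iff.mp h' _ hr
    obtain ⟨δ, hδ, hδ'⟩ := this
    refine ⟨δ, hδ, fun a ha => ?_⟩
    have := hδ' ha
    rwa [dist_eq_norm, qrotFun_one] at this
  obtain ⟨δ₁, hδ₁, h₁⟩ := hc ksE0
  obtain ⟨δ₂, hδ₂, h₂⟩ := hc northVec
  set δ := min (min δ₁ δ₂) (1 / 8) with hδdef
  have hδ : 0 < δ := by positivity
  have hone : ∀ a : ℍ, a ∈ Metric.ball (1 : ℍ) δ →
      gTotal ‖a‖ * Bweight hε (qrotFun a ksE0) (qrotFun a northVec) = 1 := by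
    intro a ha
    rw [Metric.mem_ball] at ha
    have ha1 : dist a 1 < δ₁ := lt_of_lt_of_le ha ((min_le_left _ _).trans (min_le_left _ _))
    have ha2 : dist a 1 < δ₂ := lt_of_lt_of_le ha ((min_le_left _ _).trans (min_le_right _ _))
    have ha3 : dist a 1 < 1 / 8 := lt_of_lt_of_le ha (min_le_right _ _)
    have hn : |‖a‖ - 1| < 1 / 8 := by
      rw [dist_eq_norm] at ha3
      calc |‖a‖ - 1| = |‖a‖ - ‖(1 : ℍ)‖| := by rw [norm_one]
        _ ≤ ‖a - 1‖ := abs_norm_sub_norm_le _ _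
        _ < 1 / 8 := ha3
    obtain ⟨hn1, hn2⟩ := abs_lt.mp hn
    rw [gTotal_eq_one (by linarith) (by linarith), one_mul, Bweight]
    rw [(dirBump hε).one_of_mem_closedBall, (normalBump hε).one_of_mem_closedBall, one_mul, ENNReal.ofReal_one]
    · rw [Metric.mem_closedBall, dist_eq_norm]; exact (h₂ a ha2).le
    · rw [Metric.mem_closedBall, dist_eq_norm]; exact (h₁ a ha1).le
  calc (0 : ℝ≥0∞) < volume (Metric.ball (1 : ℍ) δ) := Metric.measure_ball_pos _ _ hδ
    _ = ∫⁻ a in Metric.ball (1 : ℍ) δ, (1 : ℝ≥0∞) := by rw [setLIntegral_const, one_mul]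
    _ = ∫⁻ a in Metric.ball (1 : ℍ) δ, gTotal ‖a‖ * Bweight hε (qrotFun a ksE0) (qrotFun a northVec) :=
        setLIntegral_congr_fun measurableSet_ball fun a ha => (hone a ha).symm
    _ ≤ _ := setLIntegral_le_lintegral _ _

/-- **`c_K < ∞`** for the shell profile. [folklore] -/
theorem ksRadialConst_gTotal_lt_top : ksRadialConst gTotal < ⊤ := by
  unfold ksRadialConst
  set K : Set ℝ := Icc (1 / 4) 4
  have hle : ∀ s ∈ Ioi (0 : ℝ), ENNReal.ofReal (s ^ 3)⁻¹ * gTotal (Real.sqrt s)⁻¹ ≤ K.indicator (fun _ => (64 : ℝ≥0∞)) s := by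
    intro s hs
    rw [mem_Ioi] at hs
    have hsq : 0 < Real.sqrt s := Real.sqrt_pos.mpr hs
    by_cases hK : s ∈ K
    · rw [indicator_of_mem hK]
      obtain ⟨hK1, -⟩ := hK
      calc _ ≤ ENNReal.ofReal (s ^ 3)⁻¹ * 1 := by gcongr; exact gTotal_le_one _
        _ ≤ 64 := by
          rw [mul_one]
          refine ENNReal.ofReal_le_of_le_toReal ?_
          rw [show (64 : ℝ≥0∞).toReal = 64 by norm_num, inv_le_comm₀ (by positivity) (by norm_num)]
          calc (64 : ℝ)⁻¹ = (1 / 4) ^ 3 := by norm_num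
            _ ≤ s ^ 3 := by gcongr
    · rw [indicator_of_notMem hK]
      simp only [K, mem_Icc, not_and_or, not_le] at hK
      rcases hK with h | h
      · -- `s < 1/4`: `1/√s > 2 > 3/2`
        have : (3 / 2 : ℝ) < (Real.sqrt s)⁻¹ := by
          rw [lt_inv_comm₀ (by norm_num) hsq]
          calc Real.sqrt s < Real.sqrt (1 / 4) := Real.sqrt_lt_sqrt hs.le h
            _ = 1 / 2 := by rw [show (1 / 4 : ℝ) = (1 / 2) ^ 2 by norm_num, Real.sqrt_sq (by norm_num)]
            _ < (3 / 2 : ℝ)⁻¹ := by norm_num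
        rw [gTotal_eq_zero_of_lt this, mul_zero]
      · -- `s > 4`: `1/√s < 1/2`
        have : (Real.sqrt s)⁻¹ < 1 / 2 := by
          rw [inv_lt_comm₀ hsq (by norm_num)]
          calc (1 / 2 : ℝ)⁻¹ = Real.sqrt 4 := by
                rw [show (4 : ℝ) = 2 ^ 2 by norm_num, Real.sqrt_sq (by norm_num)]; norm_num
            _ < Real.sqrt s := Real.sqrt_lt_sqrt (by norm_num) h
        rw [gTotal_eq_zero_of_lt' this, mul_zero]
  calc _ ≤ ∫⁻ s in Ioi (0 : ℝ), K.indicator (fun _ => (64 : ℝ≥0∞)) s := setLIntegral_mono' measurableSet_Ioi hle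
    _ ≤ ∫⁻ s, K.indicator (fun _ => (64 : ℝ≥0∞)) s := setLIntegral_le_lintegral _ _
    _ = 64 * volume K := by rw [lintegral_indicator measurableSet_Icc, setLIntegral_const]
    _ < ⊤ := ENNReal.mul_lt_top (by norm_num) (by simp [K, Real.volume_Icc])

/-- **`c_K > 0`**: near `s = 1` the integrand is at least `1/2`. [folklore] -/
theorem ksRadialConst_gTotal_pos : 0 < ksRadialConst gTotal := by
  unfold ksRadialConst
  set J : Set ℝ := Ioo (9 / 10) (11 / 10)
  have hJ : J ⊆ Ioi 0 := fun s hs => lt_trans (by norm_num) hs.1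
  have hge : ∀ s ∈ J, (1 / 2 : ℝ≥0∞) ≤ ENNReal.ofReal (s ^ 3)⁻¹ * gTotal (Real.sqrt s)⁻¹ := by
    intro s hs
    obtain ⟨hs1, hs2⟩ := hs
    have hs0 : 0 < s := by linarith
    have hsq : 0 < Real.sqrt s := Real.sqrt_pos.mpr hs0
    -- `1/√s ∈ [4/5, 6/5]`
    have hlo : (4 / 5 : ℝ) ≤ (Real.sqrt s)⁻¹ := by
      rw [le_inv_comm₀ (by norm_num) hsq]
      calc Real.sqrt s ≤ Real.sqrt ((5 / 4) ^ 2) := Real.sqrt_le_sqrt (by nlinarith)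
        _ = (4 / 5 : ℝ)⁻¹ := by rw [Real.sqrt_sq (by norm_num)]; norm_num
    have hhi : (Real.sqrt s)⁻¹ ≤ (6 / 5 : ℝ) := by
      rw [inv_le_comm₀ hsq (by norm_num)]
      calc (6 / 5 : ℝ)⁻¹ = Real.sqrt ((5 / 6) ^ 2) := by rw [Real.sqrt_sq (by norm_num)]; norm_num
        _ ≤ Real.sqrt s := Real.sqrt_le_sqrt (by nlinarith)
    rw [gTotal_eq_one hlo hhi, mul_one]
    have h12 : (1 / 2 : ℝ≥0∞) = ENNReal.ofReal (1 / 2) := by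
      rw [ENNReal.ofReal_div_of_pos two_pos, ENNReal.ofReal_one, ENNReal.ofReal_ofNat]
    rw [h12]
    refine ENNReal.ofReal_le_ofReal ?_
    rw [le_inv_comm₀ (by norm_num) (by positivity)]
    calc s ^ 3 ≤ (11 / 10) ^ 3 := by gcongr
      _ ≤ (1 / 2 : ℝ)⁻¹ := by norm_num
  calc (0 : ℝ≥0∞) < 1 / 2 * volume J := by
        refine ENNReal.mul_pos (by norm_num) ?_
        have : volume J = ENNReal.ofReal (11 / 10 - 9 / 10) := by simp [J, Real.volume_Ioo]
        rw [this]; exact (ENNReal.ofReal_pos.mpr (by norm_num)).ne'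
    _ = ∫⁻ s in J, (1 / 2 : ℝ≥0∞) := by rw [setLIntegral_const]
    _ ≤ ∫⁻ s in J, ENNReal.ofReal (s ^ 3)⁻¹ * gTotal (Real.sqrt s)⁻¹ := setLIntegral_mono' measurableSet_Ioo hge
    _ ≤ _ := lintegral_mono_set hJ

/-- **The disintegration constant is positive and finite.** [folklore] -/
theorem rotDensityConstE_pos_lt_top (hε : 0 < ε₀) : 0 < rotDensityConstE hε ∧ rotDensityConstE hε < ⊤ := by
  unfold rotDensityConstE
  have h1 := frameConst_pos hε
  have h2 := frameConst_lt_top hε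
  have h3 := ksRadialConst_gTotal_pos
  have h4 := ksRadialConst_gTotal_lt_top
  have hπ : (0 : ℝ≥0∞) < ENNReal.ofReal (2 * π) := ENNReal.ofReal_pos.mpr (by positivity)
  have hπ4 : (0 : ℝ≥0∞) < ENNReal.ofReal (π / 4) := ENNReal.ofReal_pos.mpr (by positivity)
  constructor
  · exact ENNReal.mul_pos h1.ne' (ENNReal.mul_pos hπ.ne' (ENNReal.pow_pos (ENNReal.mul_pos hπ4.ne' h3.ne') 2).ne').ne'
  · refine ENNReal.mul_lt_top h2 (ENNReal.mul_lt_top ENNReal.ofReal_lt_top ?_)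
    exact ENNReal.pow_lt_top (ENNReal.mul_lt_top ENNReal.ofReal_lt_top h4)

/-- The real disintegration constant is positive. [folklore] -/
theorem rotDensityConst_pos (hε : 0 < ε₀) : 0 < rotDensityConst hε :=
  ENNReal.toReal_pos (rotDensityConstE_pos_lt_top hε).1.ne' (rotDensityConstE_pos_lt_top hε).2.ne

end Constants

/-! ### Tao's weight is identically one on the support of the cut-offs -/

section WeightOne

variable {ε₀ : ℝ}

/-- **`w ≡ 1` on the support** (Tao, after (3.14): "the weight `w(R₁ξ₁,R₂ξ₂,R₃ξ₃)` appearing in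
(3.12) is equal to one (for `ε₀` small enough)"): if `ε₀ ≤ 1/100` and the magnitude and frame
cut-offs do not vanish at `ξ`, then `singleScaleWeight ε₀ ξ = 1`. [cite: Tao2016AveragedNS, §3.6 (3.14) p. 18] -/
theorem singleScaleWeight_eq_one_of_cutoffs (hε : 0 < ε₀) (hε1 : ε₀ ≤ 1 / 100) {p : ℝ³ × ℝ³}
    (hR : pRad hε p ≠ 0) (hB : pFrame hε p ≠ 0) : singleScaleWeight ε₀ p = 1 := by
  have ht0 : 0 < ε₀ ^ 3 := eps_cube_pos hε
  have hε2 : 0 < ε₀ ^ 2 := pow_pos hε 2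
  have hnear := near_xi0_of_cutoffs hε (by linarith) hR hB
  obtain ⟨hr1, -⟩ := radii_of_pRad_ne_zero hε hR 0
  obtain ⟨hr2, -⟩ := radii_of_pRad_ne_zero hε hR 1
  obtain ⟨hr3, -⟩ := radii_of_pRad_ne_zero hε hR 2
  rw [freq3_zero, norm_xi0_zero] at hr1
  rw [freq3_one, norm_xi0_one] at hr2
  rw [freq3_two, norm_xi0_two] at hr3
  obtain ⟨h1a, h1b⟩ := abs_lt.mp hr1
  obtain ⟨h2a, h2b⟩ := abs_lt.mp hr2
  obtain ⟨h3a, h3b⟩ := abs_lt.mp hr3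
  have hcube : ε₀ ^ 3 ≤ ε₀ ^ 2 / 100 := by
    rw [pow_succ]; nlinarith
  have hε3 : ε₀ ^ 3 ≤ 1 / 100 := by
    calc ε₀ ^ 3 ≤ (1 / 100) ^ 3 := by gcongr
      _ ≤ 1 / 100 := by norm_num
  have hs : Real.sqrt 2 < 1.42 := by
    rw [show (1.42 : ℝ) = Real.sqrt (1.42 ^ 2) by rw [Real.sqrt_sq (by norm_num)]]
    exact Real.sqrt_lt_sqrt (by norm_num) (by norm_num)
  have hs0 : 0 < Real.sqrt 2 := by positivity
  unfold singleScaleWeight eta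
  have e1 : freqCutoff (‖p.1 - xi0 0‖ / ε₀ ^ 2) = 1 := by
    apply freqCutoff_eq_one
    rw [abs_div, abs_of_pos hε2, abs_of_nonneg (norm_nonneg _), div_le_one hε2]
    have := hnear 0
    rw [freq3_zero] at this
    linarith
  have hN1 : 1 / 2 < ‖p.1‖ := by linarith
  have hN1' : ‖p.1‖ ≠ 0 := by linarith
  have hsc : 10 * ε₀ ^ 2 * (1 / 2) ≤ 10 * ε₀ ^ 2 * ‖p.1‖ := mul_le_mul_of_nonneg_left hN1.le (by positivity)
  have hx1 : Real.sqrt 2 * (‖p.1‖ - 1) < 1.42 * (4 * ε₀ ^ 3) := by nlinarith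
  have hx2 : -(1.42 * (4 * ε₀ ^ 3)) < Real.sqrt 2 * (‖p.1‖ - 1) := by nlinarith
  have e2 : freqCutoff ((‖p.2‖ / ‖p.1‖ - ‖xi0 1‖ / ‖xi0 0‖) / (10 * ε₀ ^ 2)) = 1 := by
    apply freqCutoff_eq_one
    rw [norm_xi0_one, norm_xi0_zero, div_one, abs_div, abs_of_pos (by positivity : (0 : ℝ) < 10 * ε₀ ^ 2),
      div_le_one (by positivity)]
    rw [show ‖p.2‖ / ‖p.1‖ - Real.sqrt 2 = (‖p.2‖ - Real.sqrt 2 * ‖p.1‖) / ‖p.1‖ by field_simp, abs_div,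
      abs_of_pos (a := ‖p.1‖) (by linarith), div_le_iff₀ (by linarith)]
    rw [show ‖p.2‖ - Real.sqrt 2 * ‖p.1‖ = (‖p.2‖ - Real.sqrt 2) - Real.sqrt 2 * (‖p.1‖ - 1) by ring, abs_le]
    constructor <;> linarith
  have e3 : freqCutoff ((‖-p.1 - p.2‖ / ‖p.1‖ - ‖xi0 2‖ / ‖xi0 0‖) / (10 * ε₀ ^ 2)) = 1 := by
    apply freqCutoff_eq_one
    rw [norm_xi0_two, norm_xi0_zero, div_one, abs_div, abs_of_pos (by positivity : (0 : ℝ) < 10 * ε₀ ^ 2),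
      div_le_one (by positivity)]
    rw [show ‖-p.1 - p.2‖ / ‖p.1‖ - 1 = (‖-p.1 - p.2‖ - ‖p.1‖) / ‖p.1‖ by field_simp, abs_div,
      abs_of_pos (a := ‖p.1‖) (by linarith), div_le_iff₀ (by linarith)]
    rw [show ‖-p.1 - p.2‖ - ‖p.1‖ = (‖-p.1 - p.2‖ - 1) - (‖p.1‖ - 1) by ring, abs_le]
    constructor <;> linarith
  rw [e1, e2, e3, one_mul, one_mul]

end WeightOne
/-! ### Smooth building blocks -/

section Smooth

variable {ε₀ : ℝ} (ψ : Fin 3 → 𝓢(ℝ³, ℂ³))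

/-- Local notation for the smoothness exponent `C^∞`. -/
local notation "n∞" => ((⊤ : ℕ∞) : WithTop ℕ∞)

/-- A coordinate of `ℂ³` is (real-)smooth. [folklore] -/
theorem contDiff_capply (i : Fin 3) : ContDiff ℝ n∞ fun z : ℂ³ => z i :=
  ((EuclideanSpace.proj i : ℂ³ →L[ℂ] ℂ).contDiff.restrict_scalars ℝ)

/-- `cdot` is smooth (bilinear). [folklore] -/
theorem contDiff_cdot : ContDiff ℝ n∞ fun x : ℂ³ × ℂ³ => cdot x.1 x.2 := by
  unfold cdot
  exact ContDiff.sum fun i _ => ((contDiff_capply i).comp contDiff_fst).mul ((contDiff_capply i).comp contDiff_snd)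

/-- `cdot` of smooth functions is smooth. [folklore] -/
theorem contDiffAt_cdot {X : Type*} [NormedAddCommGroup X] [NormedSpace ℝ X] {f g : X → ℂ³} {x : X}
    (hf : ContDiffAt ℝ n∞ f x) (hg : ContDiffAt ℝ n∞ g x) : ContDiffAt ℝ n∞ (fun y => cdot (f y) (g y)) x :=
  contDiff_cdot.contDiffAt.comp x (hf.prodMk hg)

/-- `complexify` is smooth (real-linear). [folklore] -/
theorem contDiff_complexify' : ContDiff ℝ n∞ (complexify : ℝ³ → ℂ³) :=
  (complexify (ι := Fin 3)).contDiff

/-- The real part vector is smooth (real-linear). [folklore] -/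
theorem contDiff_reVec3 : ContDiff ℝ n∞ fun z : ℂ³ => (WithLp.toLp 2 fun j => (z j).re : ℝ³) :=
  contDiff_euclidean.2 fun i => Complex.reCLM.contDiff.comp (contDiff_capply i)

/-- The imaginary part vector is smooth (real-linear). [folklore] -/
theorem contDiff_imVec3 : ContDiff ℝ n∞ fun z : ℂ³ => (WithLp.toLp 2 fun j => (z j).im : ℝ³) :=
  contDiff_euclidean.2 fun i => Complex.imCLM.contDiff.comp (contDiff_capply i)

/-- `p ↦ (ξ₁, ξ₂, ξ₃)` is smooth (linear). [folklore] -/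
theorem contDiff_freq3 : ContDiff ℝ n∞ fun p : ℝ³ × ℝ³ => freq3 p := by
  refine contDiff_pi.2 fun j => ?_
  fin_cases j
  · exact contDiff_fst
  · exact contDiff_snd
  · exact (contDiff_fst.neg).sub contDiff_snd

/-- Each frequency is a smooth function of the pair. [folklore] -/
theorem contDiff_freq3_apply (j : Fin 3) : ContDiff ℝ n∞ fun p : ℝ³ × ℝ³ => freq3 p j :=
  (contDiff_apply ℝ ℝ³ j).comp contDiff_freq3

/-- Each slot quaternion is a smooth function (linear). [folklore] -/
theorem contDiff_slotQ (j : Fin 3) : ContDiff ℝ n∞ fun q : ℍ × ℍ × ℍ => slotQ q j := by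
  fin_cases j
  · exact contDiff_fst.comp contDiff_snd
  · exact contDiff_snd.comp contDiff_snd
  · exact contDiff_fst

/-- **`ρ(q) ⊗ 1` on `ℂ³` through real and imaginary parts.** [folklore] -/
theorem rotMat_qrot_eq {q : ℍ} (hq : q ≠ 0) (z : ℂ³) :
    rotMat (qrot q) z = complexify (qrotFun q (WithLp.toLp 2 fun j => (z j).re)) +
      Complex.I • complexify (qrotFun q (WithLp.toLp 2 fun j => (z j).im)) := by
  rw [rotMat, complexifyCLM_eq_re_add_im]
  simp only [LinearIsometry.coe_toContinuousLinearMap, LinearIsometryEquiv.coe_toLinearIsometry, qrot_apply hq]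

/-- `(q, z) ↦ (ρ(q) ⊗ 1) z` is smooth off `q = 0`. [folklore] -/
theorem contDiffAt_rotMat_qrot {x : ℍ × ℂ³} (hx : x.1 ≠ 0) :
    ContDiffAt ℝ n∞ (fun y : ℍ × ℂ³ => rotMat (qrot y.1) y.2) x := by
  have hopen : ∀ᶠ y in nhds x, y.1 ≠ 0 := (isOpen_ne.preimage continuous_fst).mem_nhds hx
  have key : ContDiffAt ℝ n∞ (fun y : ℍ × ℂ³ => complexify (qrotFun y.1 (WithLp.toLp 2 fun j => (y.2 j).re)) +
      Complex.I • complexify (qrotFun y.1 (WithLp.toLp 2 fun j => (y.2 j).im))) x := by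
    have hre : ContDiffAt ℝ n∞ (fun y : ℍ × ℂ³ => (y.1, (WithLp.toLp 2 fun j => (y.2 j).re : ℝ³))) x :=
      contDiffAt_fst.prodMk (contDiff_reVec3.contDiffAt.comp x contDiffAt_snd)
    have him : ContDiffAt ℝ n∞ (fun y : ℍ × ℂ³ => (y.1, (WithLp.toLp 2 fun j => (y.2 j).im : ℝ³))) x :=
      contDiffAt_fst.prodMk (contDiff_imVec3.contDiffAt.comp x contDiffAt_snd)
    have hx1 : (x.1, (WithLp.toLp 2 fun j => (x.2 j).re : ℝ³)).1 ≠ 0 := hx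
    have hx2 : (x.1, (WithLp.toLp 2 fun j => (x.2 j).im : ℝ³)).1 ≠ 0 := hx
    have h1 := (contDiffAt_qrotFun (n := n∞) hx1).comp x hre
    have h2 := (contDiffAt_qrotFun (n := n∞) hx2).comp x him
    exact (contDiff_complexify'.contDiffAt.comp x h1).add
      ((contDiff_complexify'.contDiffAt.comp x h2).const_smul Complex.I)
  refine key.congr_of_eventuallyEq ?_
  filter_upwards [hopen] with y hy
  exact rotMat_qrot_eq hy y.2

/-- The projection `P_ζ v` is smooth in `(ζ, v)` off `ζ = 0`. [folklore] -/
theorem contDiffAt_projPerp {x : ℝ³ × ℂ³} (hx : x.1 ≠ 0) :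
    ContDiffAt ℝ n∞ (fun y : ℝ³ × ℂ³ => projPerp y.1 y.2) x := by
  unfold projPerp
  have hu : ContDiffAt ℝ n∞ (fun y : ℝ³ × ℂ³ => complexify (udir y.1)) x :=
    contDiff_complexify'.contDiffAt.comp x ((contDiffAt_udir hx).comp x contDiffAt_fst)
  exact contDiffAt_snd.sub ((contDiffAt_cdot contDiffAt_snd hu).smul hu)

/-- The profile coefficient `\overline{ψ̂ⱼ}` is smooth. [folklore] -/
theorem contDiff_aVec (j : Fin 3) : ContDiff ℝ n∞ (aVec ψ j) := by
  unfold aVec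
  have h : ContDiff ℝ n∞ (𝓕 (⇑(ψ j))) := by
    rw [← SchwartzMap.fourier_coe]; exact (𝓕 (ψ j)).smooth ⊤
  exact conj3.toContinuousLinearMap.contDiff.comp h

/-- The frame vector `W^s(v, m)` is smooth in `(v, m)` off `v = 0`. [folklore] -/
theorem contDiffAt_frameW {x : ℝ³ × ℝ³} (hx : x.1 ≠ 0) (s : ℤˣ) :
    ContDiffAt ℝ n∞ (fun y : ℝ³ × ℝ³ => frameW y.1 y.2 s) x := by
  unfold frameW
  have hc : ContDiffAt ℝ n∞ (fun y : ℝ³ × ℝ³ => cross (udir y.1) y.2) x :=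
    contDiff_cross.contDiffAt.comp x (((contDiffAt_udir hx).comp x contDiffAt_fst).prodMk contDiffAt_snd)
  exact (contDiff_complexify'.contDiffAt.comp x contDiffAt_snd).sub
    ((contDiff_complexify'.contDiffAt.comp x hc).const_smul _)

/-- `Λ` is smooth in all five arguments (a polynomial). [folklore] -/
theorem contDiffAt_Lambda {X : Type*} [NormedAddCommGroup X] [NormedSpace ℝ X] {a b : X → ℝ³} {f g h : X → ℂ³} {x : X}
    (ha : ContDiffAt ℝ n∞ a x) (hb : ContDiffAt ℝ n∞ b x) (hf : ContDiffAt ℝ n∞ f x) (hg : ContDiffAt ℝ n∞ g x)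
    (hh : ContDiffAt ℝ n∞ h x) : ContDiffAt ℝ n∞ (fun y => Λ (a y) (b y) (f y) (g y) (h y)) x := by
  unfold Λ
  have hca : ContDiffAt ℝ n∞ (fun y => complexify (a y)) x := contDiff_complexify'.contDiffAt.comp x ha
  have hcb : ContDiffAt ℝ n∞ (fun y => complexify (b y)) x := contDiff_complexify'.contDiffAt.comp x hb
  exact ((contDiffAt_cdot hf hcb).mul (contDiffAt_cdot hg hh)).add ((contDiffAt_cdot hg hca).mul (contDiffAt_cdot hf hh))

/-! ### Smoothness of the joint weight -/

/-- The non-degeneracy radius `δ` of `lambdaSigma_ne_zero_near_xi0`. [cite: Tao2016AveragedNS, §3.9 (3.24) p. 20] -/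
def ndDelta : ℝ := Classical.choose lambdaSigma_ne_zero_near_xi0

/-- `δ > 0`. [folklore] -/
theorem ndDelta_pos : 0 < ndDelta := (Classical.choose_spec lambdaSigma_ne_zero_near_xi0).1

/-- The defining property of `δ`. [cite: Tao2016AveragedNS, §3.9 (3.24) p. 20] -/
theorem ndDelta_spec (η : Fin 3 → ℝ³) (hη : ∀ j, ‖η j - xi0 j‖ ≤ ndDelta) (hsum : η 0 + η 1 + η 2 = 0) :
    (∀ j, η j ≠ 0) ∧ cross (η 0) (η 1) ≠ 0 ∧ ‖gammaNormal η‖ = 1 ∧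
      (∀ j, ⟪gammaNormal η, η j⟫ = 0) ∧ ∀ σ, lambdaSigma η (gammaNormal η) σ ≠ 0 :=
  (Classical.choose_spec lambdaSigma_ne_zero_near_xi0).2 η hη hsum

/-- The "good" open set where all the formulas are smooth: `qⱼ ≠ 0` and `ξ` within `δ` of (3.7). [folklore] -/
def GoodSet : Set ((ℍ × ℍ × ℍ) × (ℝ³ × ℝ³)) :=
  {x | (∀ j, slotQ x.1 j ≠ 0) ∧ ∀ j, ‖freq3 x.2 j - xi0 j‖ < ndDelta}

/-- The good set is open. [folklore] -/
theorem isOpen_goodSet : IsOpen GoodSet := by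
  have h1 : ∀ j, IsOpen {x : (ℍ × ℍ × ℍ) × (ℝ³ × ℝ³) | slotQ x.1 j ≠ 0} := fun j =>
    isOpen_ne.preimage ((contDiff_slotQ j).continuous.comp continuous_fst)
  have h2 : ∀ j, IsOpen {x : (ℍ × ℍ × ℍ) × (ℝ³ × ℝ³) | ‖freq3 x.2 j - xi0 j‖ < ndDelta} := fun j =>
    isOpen_lt (((contDiff_freq3_apply j).continuous.comp continuous_snd).sub continuous_const).norm
      continuous_const
  have : GoodSet = (⋂ j, {x | slotQ x.1 j ≠ 0}) ∩ ⋂ j, {x | ‖freq3 x.2 j - xi0 j‖ < ndDelta} := by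
    ext x; simp [GoodSet]
  rw [this]
  exact (isOpen_iInter_of_finite h1).inter (isOpen_iInter_of_finite h2)

variable {ψ}

/-- **Smoothness of the real cut-off on the good set.** [folklore] -/
theorem contDiffAt_realCut (hε : 0 < ε₀) {x : (ℍ × ℍ × ℍ) × (ℝ³ × ℝ³)} (hx : x ∈ GoodSet) :
    ContDiffAt ℝ n∞ (fun y : (ℍ × ℍ × ℍ) × (ℝ³ × ℝ³) => realCut hε y.1 y.2) x := by
  obtain ⟨hq, hp⟩ := hx
  obtain ⟨hne, hcr, -, -, -⟩ := ndDelta_spec (freq3 x.2) (fun j => (hp j).le) (freq3_sum x.2)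
  -- the pieces
  have hnorm : ∀ j, ContDiffAt ℝ n∞ (fun y : (ℍ × ℍ × ℍ) × (ℝ³ × ℝ³) => ‖freq3 y.2 j‖) x := fun j =>
    (contDiffAt_norm ℝ (hne j)).comp x ((contDiff_freq3_apply j).contDiffAt.comp x contDiffAt_snd)
  have hqCut : ContDiffAt ℝ n∞ (fun y : (ℍ × ℍ × ℍ) × (ℝ³ × ℝ³) => qCut y.1) x := by
    have hq' : ContDiff ℝ n∞ qCut := by
      unfold qCut
      exact ((gBump2.contDiff.comp ((contDiff_norm_sq ℝ).comp contDiff_fst)).mul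
        (gBump2.contDiff.comp ((contDiff_norm_sq ℝ).comp (contDiff_fst.comp contDiff_snd)))).mul
        (gBump2.contDiff.comp ((contDiff_norm_sq ℝ).comp (contDiff_snd.comp contDiff_snd)))
    have h := hq'.contDiffAt.comp x (contDiffAt_fst (E := ℍ × ℍ × ℍ) (F := ℝ³ × ℝ³))
    exact h
  have hpRad : ContDiffAt ℝ n∞ (fun y : (ℍ × ℍ × ℍ) × (ℝ³ × ℝ³) => pRad hε y.2) x := by
    unfold pRad
    exact (((hnorm 0).mul (hnorm 1)).mul (hnorm 2)).mul
      ((((kappaBump hε 0).contDiff.contDiffAt.comp x (hnorm 0)).mul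
        ((kappaBump hε 1).contDiff.contDiffAt.comp x (hnorm 1))).mul
        ((kappaBump hε 2).contDiff.contDiffAt.comp x (hnorm 2)))
  have hnVec : ContDiffAt ℝ n∞ (fun y : (ℍ × ℍ × ℍ) × (ℝ³ × ℝ³) => nVec y.2) x := by
    have hF : ContDiffAt ℝ n∞ (fun y : (ℍ × ℍ × ℍ) × (ℝ³ × ℝ³) => freq3 y.2) x :=
      contDiff_freq3.contDiffAt.comp x contDiffAt_snd
    have h := (contDiffAt_gammaNormal (n := n∞) hcr).comp x hF
    exact h
  have hpFrame : ContDiffAt ℝ n∞ (fun y : (ℍ × ℍ × ℍ) × (ℝ³ × ℝ³) => pFrame hε y.2) x := by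
    have hf2 : ContDiffAt ℝ n∞ (fun y : (ℍ × ℍ × ℍ) × (ℝ³ × ℝ³) => freq3 y.2 2) x :=
      (contDiff_freq3_apply 2).contDiffAt.comp x contDiffAt_snd
    have hu : ContDiffAt ℝ n∞ (fun y : (ℍ × ℍ × ℍ) × (ℝ³ × ℝ³) => udir (freq3 y.2 2)) x := by
      have h := (contDiffAt_udir (n := n∞) (hne 2)).comp x hf2
      exact h
    have hd : ContDiffAt ℝ n∞ (fun y : (ℍ × ℍ × ℍ) × (ℝ³ × ℝ³) => (dirBump hε) (udir (freq3 y.2 2))) x := by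
      have h := (dirBump hε).contDiff.contDiffAt.comp x hu
      exact h
    have hn' : ContDiffAt ℝ n∞ (fun y : (ℍ × ℍ × ℍ) × (ℝ³ × ℝ³) => (normalBump hε) (nVec y.2)) x := by
      have h := (normalBump hε).contDiff.contDiffAt.comp x hnVec
      exact h
    unfold pFrame
    exact hd.mul hn'
  have hzeta : ∀ j, ContDiffAt ℝ n∞ (fun y : (ℍ × ℍ × ℍ) × (ℝ³ × ℝ³) => zetaVec y.1 y.2 j) x := by
    intro j
    unfold zetaVec
    have hs : ContDiffAt ℝ n∞ (fun y : (ℍ × ℍ × ℍ) × (ℝ³ × ℝ³) => (star (slotQ y.1 j), freq3 y.2 j)) x :=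
      ((contDiff_quat_star.comp (contDiff_slotQ j)).contDiffAt.comp x contDiffAt_fst).prodMk
        ((contDiff_freq3_apply j).contDiffAt.comp x contDiffAt_snd)
    have hne0 : (star (slotQ x.1 j), freq3 x.2 j).1 ≠ 0 := by
      simpa using hq j
    have h := (contDiffAt_qrotFun (n := n∞) hne0).comp x hs
    exact h
  have hzCut : ContDiffAt ℝ n∞ (fun y : (ℍ × ℍ × ℍ) × (ℝ³ × ℝ³) => zCut hε y.1 y.2) x := by
    unfold zCut
    exact (((zetaBump hε 0).contDiff.contDiffAt.comp x (hzeta 0)).mul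
      ((zetaBump hε 1).contDiff.contDiffAt.comp x (hzeta 1))).mul
      ((zetaBump hε 2).contDiff.contDiffAt.comp x (hzeta 2))
  unfold realCut
  exact (((hqCut.mul hpRad).mul hpFrame).mul hzCut).mul contDiffAt_const

/-- **Smoothness of the synthesis sum on the good set.** [folklore] -/
theorem contDiffAt_Ssum {x : (ℍ × ℍ × ℍ) × (ℝ³ × ℝ³)} (hx : x ∈ GoodSet) :
    ContDiffAt ℝ n∞ (fun y : (ℍ × ℍ × ℍ) × (ℝ³ × ℝ³) => Ssum ψ y.1 y.2) x := by
  obtain ⟨hq, hp⟩ := hx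
  obtain ⟨hne, hcr, -, -, hlam⟩ := ndDelta_spec (freq3 x.2) (fun j => (hp j).le) (freq3_sum x.2)
  have hf : ∀ j, ContDiffAt ℝ n∞ (fun y : (ℍ × ℍ × ℍ) × (ℝ³ × ℝ³) => freq3 y.2 j) x := fun j =>
    (contDiff_freq3_apply j).contDiffAt.comp x contDiffAt_snd
  have hnVec : ContDiffAt ℝ n∞ (fun y : (ℍ × ℍ × ℍ) × (ℝ³ × ℝ³) => nVec y.2) x := by
    have hF : ContDiffAt ℝ n∞ (fun y : (ℍ × ℍ × ℍ) × (ℝ³ × ℝ³) => freq3 y.2) x :=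
      contDiff_freq3.contDiffAt.comp x contDiffAt_snd
    have h := (contDiffAt_gammaNormal (n := n∞) hcr).comp x hF
    exact h
  have hW : ∀ j s, ContDiffAt ℝ n∞ (fun y : (ℍ × ℍ × ℍ) × (ℝ³ × ℝ³) => Wvec y.2 j s) x := by
    intro j s
    unfold Wvec
    have hne0 : (freq3 x.2 j, nVec x.2).1 ≠ 0 := hne j
    have h := (contDiffAt_frameW hne0 s).comp x ((hf j).prodMk hnVec)
    exact h
  have hlamP : ∀ σ, ContDiffAt ℝ n∞ (fun y : (ℍ × ℍ × ℍ) × (ℝ³ × ℝ³) => lamP y.2 σ) x := by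
    intro σ
    unfold lamP lambdaSigma
    have hW' : ∀ j s, ContDiffAt ℝ n∞ (fun y : (ℍ × ℍ × ℍ) × (ℝ³ × ℝ³) => frameW (freq3 y.2 j) (nVec y.2) s) x := hW
    exact contDiffAt_Lambda (hf 0) (hf 1) (hW' 0 (σ 0)) (hW' 1 (σ 1)) (hW' 2 (σ 2))
  have hzeta : ∀ j, ContDiffAt ℝ n∞ (fun y : (ℍ × ℍ × ℍ) × (ℝ³ × ℝ³) => zetaVec y.1 y.2 j) x := by
    intro j
    unfold zetaVec
    have hs : ContDiffAt ℝ n∞ (fun y : (ℍ × ℍ × ℍ) × (ℝ³ × ℝ³) => (star (slotQ y.1 j), freq3 y.2 j)) x :=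
      ((contDiff_quat_star.comp (contDiff_slotQ j)).contDiffAt.comp x contDiffAt_fst).prodMk (hf j)
    have hne0 : (star (slotQ x.1 j), freq3 x.2 j).1 ≠ 0 := by simpa using hq j
    have h := (contDiffAt_qrotFun (n := n∞) hne0).comp x hs
    exact h
  have hzne : ∀ j, zetaVec x.1 x.2 j ≠ 0 := by
    intro j h0
    have : ‖zetaVec x.1 x.2 j‖ = ‖freq3 x.2 j‖ := by
      unfold zetaVec; rw [norm_qrotFun (star_ne_zero.mpr (hq j))]
    rw [h0, norm_zero] at this
    exact hne j (norm_eq_zero.mp this.symm)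
  have hcVec : ∀ j, ContDiffAt ℝ n∞ (fun y : (ℍ × ℍ × ℍ) × (ℝ³ × ℝ³) => cVec ψ y.1 y.2 j) x := by
    intro j
    unfold cVec
    have hinner : ContDiffAt ℝ n∞ (fun y : (ℍ × ℍ × ℍ) × (ℝ³ × ℝ³) =>
        projPerp (zetaVec y.1 y.2 j) (aVec ψ j (zetaVec y.1 y.2 j))) x := by
      have hne0 : (zetaVec x.1 x.2 j, aVec ψ j (zetaVec x.1 x.2 j)).1 ≠ 0 := hzne j
      have ha : ContDiffAt ℝ n∞ (fun y : (ℍ × ℍ × ℍ) × (ℝ³ × ℝ³) => aVec ψ j (zetaVec y.1 y.2 j)) x :=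
        (contDiff_aVec ψ j).contDiffAt.comp x (hzeta j)
      have h := (contDiffAt_projPerp hne0).comp x ((hzeta j).prodMk ha)
      exact h
    have hne1 : (slotQ x.1 j, projPerp (zetaVec x.1 x.2 j) (aVec ψ j (zetaVec x.1 x.2 j))).1 ≠ 0 := hq j
    have hsl : ContDiffAt ℝ n∞ (fun y : (ℍ × ℍ × ℍ) × (ℝ³ × ℝ³) => slotQ y.1 j) x :=
      (contDiff_slotQ j).contDiffAt.comp x contDiffAt_fst
    have h := (contDiffAt_rotMat_qrot hne1).comp x (hsl.prodMk hinner)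
    exact h
  have hterm : ∀ σ : Fin 3 → ℤˣ, ContDiffAt ℝ n∞ (fun y : (ℍ × ℍ × ℍ) × (ℝ³ × ℝ³) =>
      (lamP y.2 σ)⁻¹ * ∏ j, cdot (Wvec y.2 j (σ j)) (cVec ψ y.1 y.2 j)) x := by
    intro σ
    have hprod : ContDiffAt ℝ n∞ (fun y : (ℍ × ℍ × ℍ) × (ℝ³ × ℝ³) =>
        ∏ j, cdot (Wvec y.2 j (σ j)) (cVec ψ y.1 y.2 j)) x := by
      have : (fun y : (ℍ × ℍ × ℍ) × (ℝ³ × ℝ³) => ∏ j, cdot (Wvec y.2 j (σ j)) (cVec ψ y.1 y.2 j)) =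
          fun y => cdot (Wvec y.2 0 (σ 0)) (cVec ψ y.1 y.2 0) * cdot (Wvec y.2 1 (σ 1)) (cVec ψ y.1 y.2 1) *
            cdot (Wvec y.2 2 (σ 2)) (cVec ψ y.1 y.2 2) := by
        funext y; exact Fin.prod_univ_three _
      rw [this]
      exact ((contDiffAt_cdot (hW 0 (σ 0)) (hcVec 0)).mul (contDiffAt_cdot (hW 1 (σ 1)) (hcVec 1))).mul
        (contDiffAt_cdot (hW 2 (σ 2)) (hcVec 2))
    exact ((hlamP σ).inv (hlam σ)).mul hprod
  unfold Ssum
  exact ContDiffAt.sum fun σ _ => hterm σ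

/-- Off the support of the real cut-off the weight vanishes identically near every bad point:
if some `qⱼ = 0` then `qCut = 0` nearby. [folklore] -/
theorem qCut_eq_zero_of_norm_lt {q : ℍ × ℍ × ℍ} {j : Fin 3} (h : ‖slotQ q j‖ < 1 / 2) : qCut q = 0 := by
  have key : ∀ t : ℝ, 0 ≤ t → t < 1 / 2 → (gBump2 : ℝ → ℝ) (t ^ 2) = 0 := by
    intro t ht0 ht
    apply gBump2.zero_of_le_dist
    rw [Real.dist_eq, show gBump2.rOut = 3 / 4 from rfl, abs_of_neg (by nlinarith)]
    nlinarith
  unfold qCut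
  fin_cases j
  · change ‖q.2.1‖ < 1 / 2 at h; rw [key _ (norm_nonneg _) h]; ring
  · change ‖q.2.2‖ < 1 / 2 at h; rw [key _ (norm_nonneg _) h]; ring
  · change ‖q.1‖ < 1 / 2 at h; rw [key _ (norm_nonneg _) h]; ring

/-- **Smoothness of the joint weight `Fflat` on `Q × (ℝ³)²`** (for `200 ε₀³ < δ`, `ε₀ ≤ 1/10`). [cite: Tao2016AveragedNS, §3.6 p. 18] -/
theorem contDiff_Fflat (hε : 0 < ε₀) (hε1 : ε₀ ≤ 1 / 10) (hδ : 200 * ε₀ ^ 3 < ndDelta) :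
    ContDiff ℝ n∞ fun x : (ℍ × ℍ × ℍ) × (ℝ³ × ℝ³) => Fflat ψ hε x.1 x.2 := by
  refine contDiff_iff_contDiffAt.2 fun x => ?_
  by_cases hx : x ∈ GoodSet
  · unfold Fflat
    exact (Complex.ofRealCLM.contDiff.contDiffAt.comp x (contDiffAt_realCut hε hx)).mul (contDiffAt_Ssum hx)
  · -- near a bad point the weight vanishes identically
    have hzero : ∀ᶠ y in nhds x, Fflat ψ hε y.1 y.2 = 0 := by
      simp only [GoodSet, mem_setOf_eq, not_and_or, not_forall, not_not, not_lt] at hx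
      rcases hx with ⟨j, hj⟩ | ⟨j, hj⟩
      · -- `qⱼ = 0`
        have hopen : ∀ᶠ y in nhds x, ‖slotQ y.1 j‖ < 1 / 2 := by
          have hc : Continuous fun y : (ℍ × ℍ × ℍ) × (ℝ³ × ℝ³) => ‖slotQ y.1 j‖ :=
            ((contDiff_slotQ j).continuous.comp continuous_fst).norm
          refine (isOpen_lt hc continuous_const).mem_nhds ?_
          simp [hj]
        filter_upwards [hopen] with y hy
        unfold Fflat realCut
        rw [qCut_eq_zero_of_norm_lt hy]; simp only [zero_mul, Complex.ofReal_zero]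
      · -- `ξ` far from (3.7)
        have hopen : ∀ᶠ y in nhds x, 100 * ε₀ ^ 3 < ‖freq3 y.2 j - xi0 j‖ := by
          have hc : Continuous fun y : (ℍ × ℍ × ℍ) × (ℝ³ × ℝ³) => ‖freq3 y.2 j - xi0 j‖ :=
            (((contDiff_freq3_apply j).continuous.comp continuous_snd).sub continuous_const).norm
          refine (isOpen_lt continuous_const hc).mem_nhds ?_
          show 100 * ε₀ ^ 3 < ‖freq3 x.2 j - xi0 j‖
          have := eps_cube_pos hε
          linarith
        filter_upwards [hopen] with y hy
        unfold Fflat realCut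
        by_cases hR : pRad hε y.2 = 0
        · rw [hR]; simp only [mul_zero, zero_mul, Complex.ofReal_zero]
        by_cases hB : pFrame hε y.2 = 0
        · rw [hB]; simp only [mul_zero, zero_mul, Complex.ofReal_zero]
        exact absurd (near_xi0_of_cutoffs hε hε1 hR hB j) (not_le.mpr hy)
    exact (contDiffAt_const (c := (0 : ℂ))).congr_of_eventuallyEq hzero

/-- **Smoothness of `F` on `V × (ℝ³)²`.** [cite: Tao2016AveragedNS, §3.6 p. 18] -/
theorem contDiff_jointF (hε : 0 < ε₀) (hε1 : ε₀ ≤ 1 / 10) (hδ : 200 * ε₀ ^ 3 < ndDelta) :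
    ContDiff ℝ n∞ (jointF ψ hε) := by
  have e : jointF ψ hε = (fun x : (ℍ × ℍ × ℍ) × (ℝ³ × ℝ³) => Fflat ψ hε x.1 x.2) ∘
      fun x : (Fin 4 → ℝ³) × (ℝ³ × ℝ³) => (quatTripleCLE x.1, x.2) := by
    funext x; rfl
  rw [e]
  exact (contDiff_Fflat hε hε1 hδ).comp ((quatTripleCLE.contDiff.comp contDiff_fst).prodMk contDiff_snd)

/-! ### Compact support -/

/-- The weight vanishes unless all `|qⱼ| ≤ 2` and `|ξⱼ - ξⱼ⁰| ≤ 1` (`j = 1, 2`). [folklore] -/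
theorem Fflat_eq_zero_of_far (hε : 0 < ε₀) (hε1 : ε₀ ≤ 1 / 10) {q : ℍ × ℍ × ℍ} {p : ℝ³ × ℝ³}
    (h : (2 : ℝ) < ‖q.1‖ ∨ (2 : ℝ) < ‖q.2.1‖ ∨ (2 : ℝ) < ‖q.2.2‖ ∨ (1 : ℝ) < ‖p.1 - xi0 0‖ ∨ (1 : ℝ) < ‖p.2 - xi0 1‖) :
    Fflat ψ hε q p = 0 := by
  have key : ∀ t : ℝ, 2 < t → (gBump2 : ℝ → ℝ) (t ^ 2) = 0 := by
    intro t ht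
    apply gBump2.zero_of_le_dist
    rw [Real.dist_eq, show gBump2.rOut = 3 / 4 from rfl, abs_of_pos (by nlinarith)]
    nlinarith
  have ht1 : 100 * ε₀ ^ 3 < 1 := by
    calc 100 * ε₀ ^ 3 ≤ 100 * (1 / 10) ^ 3 := by gcongr
      _ < 1 := by norm_num
  unfold Fflat realCut qCut
  rcases h with h | h | h | h | h
  · rw [key _ h]; simp only [zero_mul, Complex.ofReal_zero]
  · rw [key _ h]; simp only [zero_mul, mul_zero, Complex.ofReal_zero]
  · rw [key _ h]; simp only [mul_zero, zero_mul, Complex.ofReal_zero]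
  · by_cases hR : pRad hε p = 0
    · rw [hR]; simp only [zero_mul, mul_zero, Complex.ofReal_zero]
    by_cases hB : pFrame hε p = 0
    · rw [hB]; simp only [zero_mul, mul_zero, Complex.ofReal_zero]
    have := near_xi0_of_cutoffs hε hε1 hR hB 0
    rw [freq3_zero] at this
    linarith
  · by_cases hR : pRad hε p = 0
    · rw [hR]; simp only [zero_mul, mul_zero, Complex.ofReal_zero]
    by_cases hB : pFrame hε p = 0
    · rw [hB]; simp only [zero_mul, mul_zero, Complex.ofReal_zero]
    have := near_xi0_of_cutoffs hε hε1 hR hB 1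
    rw [freq3_one] at this
    linarith

/-- **`Fflat` has compact support.** [cite: Tao2016AveragedNS, §3.6 p. 18] -/
theorem hasCompactSupport_Fflat (hε : 0 < ε₀) (hε1 : ε₀ ≤ 1 / 10) :
    HasCompactSupport fun x : (ℍ × ℍ × ℍ) × (ℝ³ × ℝ³) => Fflat ψ hε x.1 x.2 := by
  set K : Set ((ℍ × ℍ × ℍ) × (ℝ³ × ℝ³)) :=
    (Metric.closedBall 0 2 ×ˢ (Metric.closedBall 0 2 ×ˢ Metric.closedBall 0 2)) ×ˢ
      (Metric.closedBall (xi0 0) 1 ×ˢ Metric.closedBall (xi0 1) 1)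
  have hK : IsCompact K :=
    ((isCompact_closedBall _ _).prod ((isCompact_closedBall _ _).prod (isCompact_closedBall _ _))).prod
      ((isCompact_closedBall _ _).prod (isCompact_closedBall _ _))
  refine HasCompactSupport.intro hK fun x hx => ?_
  apply Fflat_eq_zero_of_far hε hε1
  simp only [K, mem_prod, Metric.mem_closedBall, dist_eq_norm, sub_zero, not_and_or, not_le] at hx
  tauto

/-- **`F` has compact support.** [cite: Tao2016AveragedNS, §3.6 p. 18] -/
theorem hasCompactSupport_jointF (hε : 0 < ε₀) (hε1 : ε₀ ≤ 1 / 10) : HasCompactSupport (jointF ψ hε) := by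
  have h := (hasCompactSupport_Fflat (ψ := ψ) hε hε1).comp_homeomorph
    (quatTripleCLE.toHomeomorph.prodCongr (Homeomorph.refl (ℝ³ × ℝ³)))
  have e : jointF ψ hε = (fun x : (ℍ × ℍ × ℍ) × (ℝ³ × ℝ³) => Fflat ψ hε x.1 x.2) ∘
      ⇑(quatTripleCLE.toHomeomorph.prodCongr (Homeomorph.refl (ℝ³ × ℝ³))) := by
    funext x; rfl
  rw [e]; exact h

end Smooth
end Literature.Analysis.FluidPDE.Tao2016
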